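/-
Copyright (c) 2026. All rights reserved.
Released under Apache 2.0 license as described in the file LICENSE.
-/
import Literature.AlgebraicGeometry.ComplexMultiplication.CyclotomicFermatCMTypesPrimeLevelLenstra
import HarnessLib

/-!
# Fité–Shparlinski's Theorem 1 and Corollary 2: `#K_ℓ = ℓ(1 − 3^{−2β})/2^{2α+2} + O(β√ℓ)`, and `K_ℓ ≠ ∅`
# for every prime `ℓ ≡ 1 (mod 3)` with `ℓ > 441 · 2^{4α} β⁴`

Layer `Literature/AlgebraicGeometry/ComplexMultiplication`; sequel of `CyclotomicFermatCMTypesPrimeLevelLenstra`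
(lit-deligne-3 gen 16: Lenstra's observation for `ℓ ≡ 7 (mod 12)` = the case `α = 1`, whose docstring lists «NOT
here: [FS] Theorem 1 itself (general `α, β`, two-sided asymptotics), Cor. 2, Thm. 4; primes `p ≢ 7 (mod 12)`»).
This file proves COROLLARY 2 AS PRINTED, for ALL `α, β`, together with the one-sided count behind it (§1–§7), and
then THEOREM 1 AS PRINTED, two-sided, from a sharper estimate with error `2β√ℓ` (§8–§9).  THEOREMS ONLY (no
definition, no named fact, no `sorry`).  As in the predecessor files, `k ∈ K_p` («`D_{k,p}` is
singular», [FS] Lemma 6 = [FGL] Thm. 4.10) is rendered by `k ≠ 0, −1 (mod p)`, `ord k ≠ 3`, and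
`¬ IsNondegenerate (cmTypeOfResidues (fermatCMType p 1 k (−1−k)) _)` — the Fermat CM type `Φ_{S_k}` of the `p`-th
cyclotomic field (the type of the simple factor `Jac(C_{k,p})` of the Fermat Jacobian `J(F_p)`) is DEGENERATE,
equivalently (tree `isNondegenerate_fermat_iff_orderOf`) `ord k`, `ord(−k²−k)` odd and `v₃(ord(−k²−k)) < v₃(ord k)`.

## The print

F. Fité, I. E. Shparlinski, *On the singularity of the Demjanenko matrix of quotients of Fermat curves*, Proc. AMS
**144** (2016) 55–63 [FiteShparlinski2016] (held `paper:arxiv-1404.5178`, p0003–p0006):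

> "Theorem 1. Let `ℓ − 1 = 2^α 3^β m` for some integers `α > 0`, `β ≥ 0` and `m` with `gcd(m, 6) = 1`. Then
> `|#K_ℓ − ℓ(1 − 3^{−2β})/2^{2α+2}| ≤ 4β²√ℓ + 33/16`."
> "Corollary 2. Let `ℓ − 1 = 2^α 3^β m` for some integers `α, β > 0` and `m` with `gcd(m, 6) = 1`. If
> `ℓ > 441 · 2^{4α} β⁴` then `#K_ℓ > 0`."
> "Lemma 6. … `k ∈ K_ℓ` if and only if (i) `ord_ℓ k ≠ 3`; (ii) `ν₂(ord_ℓ k) = ν₂(ord_ℓ(−k²−k)) = 0`;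
> (iii) `ν₃(ord_ℓ k) > ν₃(ord_ℓ(k²+k))`."  "Lemma 7. For any polynomial `Q(X) ∈ 𝔽_ℓ[X]` with `N` distinct
> zeros … `|Σ_{k∈𝔽_ℓ} χ(Q(k))| ≤ (N−1)ℓ^{1/2}`."  (§3: the character sums that occur are
> `Σ_k χ(k^f (k²+k)^g (−1)^h)`, i.e. `N = 2`: Jacobi sums.)

## What is proved, and how

[FS] expand the full indicator of (ii)∧(iii) into characters of order `2^α` and `3^{β−h}`.  For the one-sided
statement a SINGLE character `χ` of order `3q`, `q = 2^α` (`α = ν₂(ℓ − 1)`), suffices: the set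
`U = {k ≠ 0,−1 : χ(k)³ = 1, χ(k+1)³ = −1, χ(k)^q ≠ 1, (χ(k)χ(k+1))^q = 1}` — `k` a `2^α`-th power, `k + 1` with
`(k+1)^{(ℓ−1)/q} = −1`, `k` not a cube, `k(k+1)` a cube — consists of elements satisfying (ii) and (iii).

* §1 (private dictionary) a character of order `n` through a generator `g` of `(ℤ/p)ˣ`: `χ(x)^n = 1`,
  `χ^a ≠ 1` for `n ∤ a`, and `χ(x)^{n/d} = 1 ↔ x^{(p−1)/d} = 1` for `d ∣ n ∣ p − 1`.
* §2 **`degenerate_of_power_residue_conditions`** (the mechanism for general `α`): `q ∣ p − 1` with `(p−1)/q` odd,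
  `3 ∣ p − 1`, `k^{(p−1)/q} = 1`, `(k+1)^{(p−1)/q} = −1`, `k^{(p−1)/3} ≠ 1`, `(k(k+1))^{(p−1)/3} = 1` ⟹ (ii), (iii).
* §3 `weight_eq_ite`: for `(3q)`-th roots of unity `u, w` (`q` even),
  `(Σ_{a<q} u^{3a})(Σ_{b<q} (−1)^b w^{3b})(2 − u^q − u^{2q})(1 + (uw)^q + (uw)^{2q}) = 9q² · 𝟙_U`.
* §4 **`norm_sum_filter_pow_mul_pow_le_of_not_dvd`** (Lemma 7, `N = 2`: `‖Σ_{k≠0,−1} χ(k)^i χ(k+1)^j‖ ≤ √p` for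
  `(i, j) ≢ (0, 0) (mod 3q)`, via the tree's `norm_sum_mul_apply_add_one_le`), **`card_U_ge_of_order`**
  (`9q² · #U ≥ 2(p − 2) − 12q²√p`: the weight expands into the `9q²` monomials
  `(−1)^b e_c χ(k)^{3a + q(c+d)} χ(k+1)^{3b + qd}`, `e = (2, −1, −1)`; exactly one of them — `a = b = c = d = 0`,
  `index_eq_zero_of_dvd` — is trivial, with coefficient `2` and sum `2(p − 2)`; the sum of the absolute values of
  all coefficients is `12q²`).
* §5 **`power_residue_conditions_of_char`** (the four character conditions ⟹ the four power-residue conditions).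
* §6 **`card_filter_lemma6_ge`** — the ONE-SIDED COUNT: for `3 ∣ p − 1`, `2^α ‖ p − 1`,
  `#{k ≠ 0,−1 : ord k ≠ 3, (ii), (iii)} ≥ (2(p−2) − 12·4^α√p)/(9·4^α) − 2` (at most two elements of `U` have
  order `3`); **`exists_not_isNondegenerate_fermat_of_two_pow_dvd`** (`p > 441 · 2^{4α}` ⟹ `K_p ≠ ∅`, since then
  `√p > 21 · 4^α`); **`fiteShparlinski_cor_2`** = COROLLARY 2 AS PRINTED (`ℓ − 1 = 2^α 3^β m`, `α, β > 0`,
  `gcd(m,6) = 1`, `ℓ > 441 · 2^{4α} β⁴` ⟹ `K_ℓ ≠ ∅`); `exists_not_isNondegenerate_fermat_of_mod_24` (`α = 2`: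
  every prime `p ≡ 13 (mod 24)` above `112896` has `K_p ≠ ∅`).
* §7 ON ABELIAN VARIETIES: **`exists_isSimple_exceptional_pow_of_gt_bound`** — for every prime as in Cor. 2 a
  SIMPLE abelian variety of dimension `(ℓ−1)/2` of some type `Φ_{S_k}` (`ord k ≠ 3`) carries an exceptional Hodge
  class on some power (realisation by Shimura §6.2 Thm. 3 = tree `exists_isCMTypeRealisation`; exceptional class
  by the tree's `isSimple_and_exists_exceptional_pow_of_orderOf`).
* §8 **`abs_card_filter_four_sub_le`** — the GENERAL BOX COUNT: for a character `θ` of order `n` and four averaged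
  conditions `θ(k)^{c₁} = 1`, `θ(k(k+1))^{c₂} = −1`, `θ(k)^{c₃} = 1`, `θ(k(k+1))^{c₄} = 1` (periods `Nᵢ`, `n ∣ cᵢNᵢ`)
  whose box has exactly one trivial monomial: `|#{k} − (p − 2)/(N₁N₂N₃N₄)| ≤ √p`.
* §9 THEOREM 1.  With ONE character `θ` of order `2^α 3^β` (`2^α ‖ p − 1`, `3^β ‖ p − 1`) the conditions of
  Lemma 6 are character conditions EXACTLY: `ord x` odd `↔ x^{(p−1)/2^α} = 1 ↔ θ(x)^{3^β} = 1`;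
  `ord(−k²−k)` odd `↔ (k(k+1))^{(p−1)/2^α} = −1 ↔ θ(k(k+1))^{3^β} = −1`; `ν₃(ord x) ≤ j ↔ x^{(p−1)/3^{β−j}} = 1 ↔
  θ(x)^{2^α 3^j} = 1` (`dvd_div_pow_iff_padicValNat_le`).  Hence, with
  `V(j, e) = {k ≠ 0,−1 : ord(−k²−k), ord k odd, ν₃(ord k) ≤ j, ν₃(ord(−k²−k)) ≤ e}`:
  **`abs_card_filter_valuation_sub_le`** (`|#V(j,e) − (p−2)/(4^α 3^{β−j} 3^{β−e})| ≤ √p`, §8 with the box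
  `[0,2^α)² × [0,3^{β−j}) × [0,3^{β−e})`), the set `K*_p = {(ii) ∧ (iii)}` is the disjoint union over
  `r = ν₃(ord k) ∈ [1, β]` of `V(r, r−1) ∖ V(r−1, r−1)`, and summing the geometric series
  `Σ_r 2/(4^α 9^{β−r+1}) = (1 − 9^{−β})/(4·4^α)` ([FS] (2.5): «`a₀ = (1 − 3^{−2β})/2^{2α+2}`»):
  **`abs_card_lemma6_sub_main_le`** — `|#K*_p − (p − 2)(1 − 9^{−β})/(4·4^α)| ≤ 2β√p` (SHARPER than the printed
  `4β²`: [FS] expand `η_r(k) η_s(k²+k)` for all `s < r`, here `Σ_{s<r} η_s` is one indicator), and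
  **`fiteShparlinski_thm_1`** = THEOREM 1 AS PRINTED: `ℓ − 1 = 2^α 3^β m`, `α > 0`, `gcd(m,6) = 1` ⟹
  `|#K_ℓ − ℓ(1 − 3^{−2β})/2^{2α+2}| ≤ 4β²√ℓ + 33/16`, where `#K_ℓ = #{k ≠ 0,−1 : ord k ≠ 3, (ii), (iii)}`
  (`#K*_ℓ − 2 ≤ #K_ℓ ≤ #K*_ℓ`; for `β = 0` both sides vanish).

Faithfulness notes. (i) Cor. 2 is proved with the printed threshold and, in fact, with `441 · 2^{4α}` (no `β⁴`):
for `β = 1` the main term `2ℓ/(9·4^α)` of the one-sided count equals [FS]'s `ℓ(1 − 3^{−2β})/2^{2α+2}`, for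
`β ≥ 2` it is smaller (only `ν₃(ord k) = β` is counted), and the error constant is `12·4^α/(9·4^α) = 4/3` in
place of `4β²`.  (ii) [FS] use Weil's bound for `Σ χ(Q(k))`; here only `N = 2` (Jacobi sums, Mathlib + tree) is
needed, exactly as in the `α = 1` file: every monomial is `ψ(k)φ(k+1)` because `χ(−k²−k) = χ(−1)χ(k)χ(k+1)`.
(iii) The hypothesis `α > 0` of Cor. 2 / Thm. 1 is automatic (`ℓ` odd), `β > 0` in Cor. 2 is `3 ∣ ℓ − 1` (for
`β = 0`, `K_ℓ = ∅`: tree `isNondegenerate_fermat_of_not_three_dvd`).  (iv) In Thm. 1, `#K_ℓ` is the cardinality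
of a `Finset` of residues `k` (Lemma 6 in the order form of [FGL] Thm. 4.10); the identification with «`D_{k,ℓ}`
singular» for each such `k` is the tree's `isNondegenerate_fermat_iff_orderOf`.  Mathlib's convention `χ(0) = 0`
for every multiplicative character (also the trivial one) makes the sums run over `k ≠ 0, −1` directly, so the
printed corrections `B_{0,ℓ}`, `B_{−1,ℓ}` do not arise; the main term is taken at `ℓ − 2` and moved to `ℓ` in the
final step (`|2a₁| ≤ 1/2`).  NOT here: Thm. 4 (density of exceptional primes), Thm. 5's `O`-constant, the explicit
exceptional sets for `α ≥ 2` below the threshold (for `α = 1`: tree, `{7, 19, 31, 43, 79, 103}`).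

## References

* [FiteShparlinski2016] F. Fité, I. E. Shparlinski, Proc. Amer. Math. Soc. 144 (2016) 55–63 (arXiv:1404.5178): Thm. 1,
  Cor. 2, Lemma 6, Lemma 7, §2 (2.1)–(2.3), §3 (proof of Thm. 1: (2.4), (2.5), `a₀`, `Σ|aᵢ| ≤ 4β²`).
* [FiteGonzalezLario2016] F. Fité, J. González, J.-C. Lario, Canad. J. Math. 68 (2016) 361–394: Thm. 4.10, Lemma 3.3.
* [Shimura1998] G. Shimura, *Abelian Varieties with Complex Multiplication and Modular Functions*, §6.2 Thm. 3.

## Provenance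

Cell `pub-hodgecm2` (COR-CM), literature seat `lit-deligne-3` gen 17 (claims FS-COR2 — §1–§7, first filing — and
FS-THM1 — §8–§9, appended; count-neutral own lane).
-/

noncomputable section

open scoped BigOperators
open Finset ComplexConjugate

namespace Literature.AlgebraicGeometry.ComplexMultiplication

open Literature.NumberTheory.ComplexMultiplication
open Literature.AlgebraicGeometry.Motives (CMType)
open Literature.AlgebraicGeometry.HodgeTheory (fermatCMType)
open Literature.AlgebraicGeometry.Pohlmann1968 Literature.AlgebraicGeometry.Pohlmann1968.Cyclotomic

namespace CyclotomicFermatCMType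

/-! ## §1 A character of order `n` read through a generator: values vs. power residues -/

section Generator

variable {p : ℕ} [hp : Fact p.Prime]
variable {g : (ZMod p)ˣ} {ζ : ℂ} {χ : MulChar (ZMod p) ℂ} {n : ℕ}

/-- The generator has order `p − 1`. [folklore] -/
private theorem orderOf_gen_eq (hg : ∀ x : (ZMod p)ˣ, x ∈ Subgroup.zpowers g) :
    orderOf (g : ZMod p) = p - 1 := by
  rw [orderOf_units, orderOf_eq_card_of_forall_mem_zpowers hg, Nat.card_eq_fintype_card, ZMod.card_units]

/-- Every non-zero residue is a power of the generator. [folklore] -/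
private theorem exists_gen_pow_eq (hg : ∀ x : (ZMod p)ˣ, x ∈ Subgroup.zpowers g) {x : ZMod p} (hx : x ≠ 0) :
    ∃ a : ℕ, (g : ZMod p) ^ a = x := by
  have hmem : Units.mk0 x hx ∈ Submonoid.powers g := (mem_powers_iff_mem_zpowers).2 (hg _)
  obtain ⟨a, ha⟩ := (Submonoid.mem_powers_iff _ _).1 hmem
  exact ⟨a, by rw [← Units.val_pow_eq_pow_val, ha]; rfl⟩

/-- A power `g^m` of the generator is `1` iff `p − 1 ∣ m`. [folklore] -/
private theorem gen_pow_eq_one_iff (hg : ∀ x : (ZMod p)ˣ, x ∈ Subgroup.zpowers g) (m : ℕ) :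
    (g : ZMod p) ^ m = 1 ↔ p - 1 ∣ m := by
  rw [← orderOf_gen_eq hg, orderOf_dvd_iff_pow_eq_one]

/-- The power `x^{(p−1)/d}` of `x = g^a` is `1` iff `d ∣ a` (`d ∣ p − 1`). [folklore] -/
private theorem gen_pow_pow_div_eq_one_iff (hg : ∀ x : (ZMod p)ˣ, x ∈ Subgroup.zpowers g) {d : ℕ}
    (hd : d ∣ p - 1) (hd0 : 0 < d) (a : ℕ) :
    ((g : ZMod p) ^ a) ^ ((p - 1) / d) = 1 ↔ d ∣ a := by
  rw [← pow_mul, gen_pow_eq_one_iff hg]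
  obtain ⟨e, he⟩ := hd
  have he0 : 0 < e := by
    rcases Nat.eq_zero_or_pos e with rfl | h
    · have := hp.out.two_le; omega
    · exact h
  rw [he, Nat.mul_div_cancel_left e hd0]
  constructor
  · intro h
    exact Nat.dvd_of_mul_dvd_mul_right he0 h
  · intro h
    exact Nat.mul_dvd_mul_right h e

variable (hg : ∀ x : (ZMod p)ˣ, x ∈ Subgroup.zpowers g) (hζ : IsPrimitiveRoot ζ n) (hχ : χ g = ζ)
include hg hζ hχ

omit hg hζ in
/-- `χ(g^a) = ζ^a`. [folklore] -/
private theorem apply_gen_pow (a : ℕ) : χ ((g : ZMod p) ^ a) = ζ ^ a := by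
  rw [map_pow, hχ]

/-- The values of `χ` on units are `n`-th roots of unity: `χ(x)^n = 1`. [folklore] -/
private theorem apply_pow_order {x : ZMod p} (hx : x ≠ 0) : χ x ^ n = 1 := by
  obtain ⟨a, rfl⟩ := exists_gen_pow_eq hg hx
  rw [apply_gen_pow hχ, ← pow_mul, mul_comm, pow_mul, hζ.pow_eq_one, one_pow]

omit hg in
/-- `χ^a ≠ 1` unless `n ∣ a` (so `χ` has order `n`). [folklore] -/
private theorem char_pow_ne_one {a : ℕ} (ha : ¬ n ∣ a) : χ ^ a ≠ 1 := by
  intro h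
  have h1 : (χ ^ a) (g : ZMod p) = 1 := by rw [h, MulChar.one_apply_coe]
  rw [MulChar.pow_apply_coe, hχ] at h1
  exact ha (hζ.dvd_of_pow_eq_one a h1)

/-- **Dictionary (powers of values ↔ power residues)**: for `d ∣ n ∣ p − 1` and `x ≠ 0`,
`χ(x)^{n/d} = 1 ↔ x^{(p−1)/d} = 1`. [folklore] -/
private theorem apply_pow_div_eq_one_iff (hn : n ∣ p - 1) {d : ℕ} (hd : d ∣ n) (hd0 : 0 < d) {x : ZMod p}
    (hx : x ≠ 0) : χ x ^ (n / d) = 1 ↔ x ^ ((p - 1) / d) = 1 := by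
  obtain ⟨a, rfl⟩ := exists_gen_pow_eq hg hx
  rw [apply_gen_pow hχ, gen_pow_pow_div_eq_one_iff hg (dvd_trans hd hn) hd0, ← pow_mul,
    hζ.pow_eq_one_iff_dvd]
  obtain ⟨e, rfl⟩ := hd
  have he0 : 0 < e := by
    rcases Nat.eq_zero_or_pos e with rfl | h
    · exfalso
      rw [mul_zero, zero_dvd_iff] at hn
      have := hp.out.two_le; omega
    · exact h
  rw [Nat.mul_div_cancel_left e hd0]
  constructor
  · intro h
    rw [mul_comm d e] at h
    exact Nat.dvd_of_mul_dvd_mul_left he0 (by simpa [mul_comm] using h)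
  · intro h
    rw [mul_comm d e, mul_comm a e]
    exact Nat.mul_dvd_mul_left e h

end Generator

/-! ## §2 The mechanism for general `α`: power-residue conditions forcing (ii) and (iii) of Lemma 6 -/

section Mechanism

variable {p : ℕ} [hp : Fact p.Prime]

/-- If `d ∣ e ≠ 0` then `v₃(d) ≤ v₃(e)`. [folklore] -/
private theorem padicValNat_three_le_of_dvd {d e : ℕ} (he : e ≠ 0) (h : d ∣ e) :
    padicValNat 3 d ≤ padicValNat 3 e :=
  (padicValNat_dvd_iff_le he).1 (dvd_trans pow_padicValNat_dvd h)

/-- If `d ∣ 3e` but `d ∤ e` then `v₃(e) < v₃(d)`: the `3`-free part of `d` divides `e`, so the `3`-part of `d`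
cannot. [folklore] -/
private theorem padicValNat_three_lt_of_dvd_three_mul {d e : ℕ} (h1 : d ∣ 3 * e) (h2 : ¬ d ∣ e) :
    padicValNat 3 e < padicValNat 3 d := by
  have hd : d ≠ 0 := by
    rintro rfl
    rw [zero_dvd_iff] at h1
    omega
  obtain ⟨s, c, hc, hdc⟩ := Nat.exists_eq_pow_mul_and_not_dvd hd 3 (by norm_num)
  have hcop : Nat.Coprime 3 c := (Nat.Prime.coprime_iff_not_dvd Nat.prime_three).2 hc
  have hcd : c ∣ 3 * e := dvd_trans (Dvd.intro_left _ hdc.symm) h1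
  have hce : c ∣ e := (hcop.symm).dvd_of_dvd_mul_left hcd
  by_contra hlt
  rw [not_lt] at hlt
  have hs : s ≤ padicValNat 3 e := by
    have : 3 ^ s ∣ d := Dvd.intro _ hdc.symm
    exact le_trans ((padicValNat_dvd_iff_le hd).1 this) hlt
  have h3e : 3 ^ s ∣ e := dvd_trans (pow_dvd_pow 3 hs) pow_padicValNat_dvd
  have : d ∣ e := by
    rw [hdc]
    exact Nat.Coprime.mul_dvd_of_dvd_of_dvd (hcop.pow_left s) h3e hce
  exact h2 this

/-- `(p − 1)/3` is even once `3 ∣ p − 1` (then `p` is odd). [folklore] -/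
private theorem even_sub_one_div_three (h3 : 3 ∣ p - 1) : Even ((p - 1) / 3) := by
  have hp2 : p ≠ 2 := by
    rintro rfl; norm_num at h3
  have hodd : Odd p := hp.out.odd_of_ne_two hp2
  obtain ⟨c, hc⟩ := h3
  obtain ⟨r, hr⟩ := hodd
  have hc' : (p - 1) / 3 = c := by omega
  rw [hc', Nat.even_iff]
  omega

/-- **The mechanism for general `α`** (Fité–Shparlinski §3 with ONE character of order `3 · 2^α`; for `α = 1`
this is Lenstra's mechanism, tree `degenerate_of_sextic_conditions`): let `q ∣ p − 1` with `(p − 1)/q` ODD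
(`q = 2^α`, `α = v₂(p − 1)`) and `3 ∣ p − 1`.  If `k ≠ 0, −1` has `k^{(p−1)/q} = 1` (`ord k` odd),
`(k+1)^{(p−1)/q} = −1` (so `(−k(k+1))^{(p−1)/q} = (−1)·1·(−1) = 1`: `ord(−k²−k)` odd), `k^{(p−1)/3} ≠ 1` (`k` not a
cube: `v₃(ord k) = v₃(p − 1)`) and `(k(k+1))^{(p−1)/3} = 1` (`k(k+1)` a cube: `v₃(ord(−k²−k)) < v₃(p − 1)`), then
`k` satisfies (ii) and (iii) of Lemma 6 = [FGL] Thm. 4.10 (b), (c).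
[cite: FiteShparlinski2016, Lemma 6 and §3 (proof of Thm. 1)] [cite: FiteGonzalezLario2016, Thm. 4.10] -/
theorem degenerate_of_power_residue_conditions {q : ℕ} (hq : q ∣ p - 1) (hodd : Odd ((p - 1) / q))
    (h3 : 3 ∣ p - 1) {k : ZMod p} (hk : k ≠ 0) (hk1 : k + 1 ≠ 0)
    (hkq : k ^ ((p - 1) / q) = 1) (hk1q : (k + 1) ^ ((p - 1) / q) = -1)
    (hk3 : k ^ ((p - 1) / 3) ≠ 1) (hkk : (k * (k + 1)) ^ ((p - 1) / 3) = 1) :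
    Odd (orderOf (-k ^ 2 - k)) ∧ Odd (orderOf k) ∧
      padicValNat 3 (orderOf (-k ^ 2 - k)) < padicValNat 3 (orderOf k) := by
  have _hq := hq
  have _hk1 := hk1
  have heven3 : Even ((p - 1) / 3) := even_sub_one_div_three h3
  have h30 : (p - 1) / 3 ≠ 0 := by
    have := hp.out.two_le
    omega
  have hh : -k ^ 2 - k = -(k * (k + 1)) := by ring
  have hh1 : (-k ^ 2 - k) ^ ((p - 1) / q) = 1 := by
    rw [hh, neg_pow, mul_pow, hkq, hk1q, hodd.neg_one_pow]; ring
  have hh3 : (-k ^ 2 - k) ^ ((p - 1) / 3) = 1 := by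
    rw [hh, neg_pow, hkk, heven3.neg_one_pow, one_mul]
  have hdk : orderOf k ∣ 3 * ((p - 1) / 3) := by
    rw [Nat.mul_div_cancel' h3]
    exact ZMod.orderOf_dvd_card_sub_one hk
  have hndk : ¬ orderOf k ∣ (p - 1) / 3 := fun h => hk3 (orderOf_dvd_iff_pow_eq_one.1 h)
  have hdh3 : orderOf (-k ^ 2 - k) ∣ (p - 1) / 3 := orderOf_dvd_of_pow_eq_one hh3
  refine ⟨hodd.of_dvd_nat (orderOf_dvd_of_pow_eq_one hh1), hodd.of_dvd_nat (orderOf_dvd_of_pow_eq_one hkq), ?_⟩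
  exact lt_of_le_of_lt (padicValNat_three_le_of_dvd h30 hdh3) (padicValNat_three_lt_of_dvd_three_mul hdk hndk)

end Mechanism

/-! ## §3 The indicator weight of the set `U` for a character of order `3q` -/

section Weight

/-- A geometric sum over a root of unity: if `z^m = 1` then `Σ_{i<m} z^i = m` if `z = 1` and `0` otherwise.
[folklore] -/
private theorem geom_sum_eq_ite_of_pow_eq_one' {z : ℂ} {m : ℕ} (hz : z ^ m = 1) :
    ∑ i ∈ range m, z ^ i = if z = 1 then (m : ℂ) else 0 := by
  split_ifs with h
  · simp [h]
  · rw [geom_sum_eq h, hz, sub_self, zero_div]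

/-- For a cube root of unity `v`: `1 + v + v² = 3·[v = 1]`. [folklore] -/
private theorem one_add_add_sq_eq_ite {v : ℂ} (hv : v ^ 3 = 1) :
    1 + v + v ^ 2 = if v = 1 then (3 : ℂ) else 0 := by
  split_ifs with h
  · rw [h]; norm_num
  · have := (sq_add_self_add_one_eq_zero_iff v).2 ⟨hv, h⟩
    linear_combination this

/-- **The indicator weight of `U`**: for `(3q)`-th roots of unity `u, w` with `q` even,
`(Σ_{a<q} u^{3a}) (Σ_{b<q} (−1)^b w^{3b}) (2 − u^q − u^{2q}) (1 + (uw)^q + (uw)^{2q}) = 9q² · 𝟙[u³ = 1, w³ = −1,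
u^q ≠ 1, (uw)^q = 1]` (each factor is `q`, `q`, `3`, `3` times the indicator of its condition: `u³` and `−w³` are
`q`-th roots of unity, `u^q` and `(uw)^q` are cube roots of unity). [folklore] -/
private theorem weight_eq_ite {q : ℕ} (hq : Even q) {u w : ℂ} (hu : u ^ (3 * q) = 1) (hw : w ^ (3 * q) = 1) :
    (∑ a ∈ range q, u ^ (3 * a)) * (∑ b ∈ range q, (-1) ^ b * w ^ (3 * b)) * (2 - u ^ q - u ^ (2 * q)) *
        (1 + (u * w) ^ q + (u * w) ^ (2 * q)) =
      if u ^ 3 = 1 ∧ w ^ 3 = -1 ∧ u ^ q ≠ 1 ∧ (u * w) ^ q = 1 then (9 * (q : ℂ) ^ 2) else 0 := by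
  -- the four factors
  have hA : ∑ a ∈ range q, u ^ (3 * a) = if u ^ 3 = 1 then (q : ℂ) else 0 := by
    rw [← geom_sum_eq_ite_of_pow_eq_one' (z := u ^ 3) (by rw [← pow_mul]; exact hu)]
    refine Finset.sum_congr rfl fun a _ => ?_
    rw [pow_mul]
  have hB : ∑ b ∈ range q, (-1) ^ b * w ^ (3 * b) = if w ^ 3 = -1 then (q : ℂ) else 0 := by
    have hw' : (-(w ^ 3)) ^ q = 1 := by rw [hq.neg_pow, ← pow_mul]; exact hw
    have hiff : (-(w ^ 3) = 1) ↔ (w ^ 3 = -1) := by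
      constructor
      · intro h; linear_combination -h
      · intro h; rw [h, neg_neg]
    rw [← if_congr hiff rfl rfl, ← geom_sum_eq_ite_of_pow_eq_one' hw']
    refine Finset.sum_congr rfl fun b _ => ?_
    rw [pow_mul, neg_pow (w ^ 3) b]
  have hv3 : (u ^ q) ^ 3 = 1 := by rw [← pow_mul, mul_comm]; exact hu
  have hC : (2 : ℂ) - u ^ q - u ^ (2 * q) = if u ^ q ≠ 1 then (3 : ℂ) else 0 := by
    have h := one_add_add_sq_eq_ite hv3
    rw [← pow_mul, mul_comm q 2] at h
    split_ifs at h with h1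
    · rw [if_neg (not_not.2 h1)]
      linear_combination -h
    · rw [if_pos h1]
      linear_combination -h
  have hv3' : ((u * w) ^ q) ^ 3 = 1 := by
    rw [← pow_mul, mul_pow, mul_comm q 3, hu, hw, one_mul]
  have hD : (1 : ℂ) + (u * w) ^ q + (u * w) ^ (2 * q) = if (u * w) ^ q = 1 then (3 : ℂ) else 0 := by
    have h := one_add_add_sq_eq_ite hv3'
    rw [← pow_mul, mul_comm q 2] at h
    exact h
  rw [hA, hB, hC, hD]
  by_cases h1 : u ^ 3 = 1 <;> by_cases h2 : w ^ 3 = -1 <;> by_cases h3 : u ^ q ≠ 1 <;>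
    by_cases h4 : (u * w) ^ q = 1 <;> simp [h1, h2, h3, h4]
  ring

end Weight

/-! ## §4 Counting `U` with the Weil bound: `9q² · #U ≥ 2(p − 2) − 12q²√p` -/

section Counting

variable {p : ℕ} [hp : Fact p.Prime]
variable {g : (ZMod p)ˣ} {ζ : ℂ} {χ : MulChar (ZMod p) ℂ} {q : ℕ}

/-- On units a power of a character is the power of its value. [folklore] -/
private theorem pow_apply_of_ne_zero' (χ : MulChar (ZMod p) ℂ) (a : ℕ) {x : ZMod p} (hx : x ≠ 0) :
    (χ ^ a) x = χ x ^ a :=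
  MulChar.pow_apply_coe χ a (Units.mk0 x hx)

/-- The monomial sums restricted to `k ≠ 0, −1` are full pair sums of the powers `χ^i`, `χ^j` (a multiplicative
character kills `0`). [folklore] -/
private theorem sum_filter_pow_mul_pow_eq' (χ : MulChar (ZMod p) ℂ) (i j : ℕ) :
    ∑ k ∈ univ.filter (fun k : ZMod p => k ≠ 0 ∧ k + 1 ≠ 0), χ k ^ i * χ (k + 1) ^ j =
      ∑ k : ZMod p, (χ ^ i) k * (χ ^ j) (k + 1) := by
  classical
  rw [← Finset.sum_filter_add_sum_filter_not univ (fun k : ZMod p => k ≠ 0 ∧ k + 1 ≠ 0)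
    (fun k => (χ ^ i) k * (χ ^ j) (k + 1))]
  have h2 : ∑ k ∈ univ.filter (fun k : ZMod p => ¬ (k ≠ 0 ∧ k + 1 ≠ 0)),
      (χ ^ i) k * (χ ^ j) (k + 1) = 0 := by
    refine Finset.sum_eq_zero fun k hk => ?_
    simp only [mem_filter, mem_univ, true_and, not_and_or, not_not] at hk
    rcases hk with hk | hk
    · rw [MulChar.map_nonunit (χ ^ i) (by rw [hk]; exact not_isUnit_zero), zero_mul]
    · rw [MulChar.map_nonunit (χ ^ j) (by rw [hk]; exact not_isUnit_zero), mul_zero]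
  rw [h2, add_zero]
  refine Finset.sum_congr rfl fun k hk => ?_
  simp only [mem_filter, mem_univ, true_and] at hk
  rw [pow_apply_of_ne_zero' χ i hk.1, pow_apply_of_ne_zero' χ j hk.2]

/-- `#{k : k ≠ 0, −1} = p − 2`. [folklore] -/
private theorem card_filter_ne_zero_ne_neg_one' :
    (univ.filter (fun k : ZMod p => k ≠ 0 ∧ k + 1 ≠ 0)).card = p - 2 := by
  classical
  have hne : (0 : ZMod p) ≠ -1 := by
    intro h
    exact one_ne_zero (by linear_combination h : (1 : ZMod p) = 0)
  have hset : univ.filter (fun k : ZMod p => k ≠ 0 ∧ k + 1 ≠ 0) = univ \ {0, -1} := by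
    ext k
    simp only [mem_filter, mem_univ, true_and, mem_sdiff, mem_insert, mem_singleton, not_or]
    constructor
    · rintro ⟨h0, h1⟩
      exact ⟨h0, fun h => h1 (by rw [h, neg_add_cancel])⟩
    · rintro ⟨h0, h1⟩
      exact ⟨h0, fun h => h1 (by linear_combination h)⟩
  rw [hset, Finset.card_sdiff_of_subset (subset_univ _), Finset.card_univ, ZMod.card, Finset.card_pair hne]

variable (hg : ∀ x : (ZMod p)ˣ, x ∈ Subgroup.zpowers g) (hζ : IsPrimitiveRoot ζ (3 * q)) (hχ : χ g = ζ)
include hg hζ hχ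

omit hg in
/-- **Weil bound for the restricted monomial sums `T(i, j) = Σ_{k ≠ 0,−1} χ(k)^i χ(k+1)^j`**, `(i, j) ≢ (0, 0)
(mod 3q)`: `‖T(i, j)‖ ≤ √p` (a Jacobi sum; tree `norm_sum_mul_apply_add_one_le`).
[cite: FiteShparlinski2016, Lemma 7] -/
theorem norm_sum_filter_pow_mul_pow_le_of_not_dvd {i j : ℕ} (hij : ¬ 3 * q ∣ i ∨ ¬ 3 * q ∣ j) :
    ‖∑ k ∈ univ.filter (fun k : ZMod p => k ≠ 0 ∧ k + 1 ≠ 0), χ k ^ i * χ (k + 1) ^ j‖ ≤ Real.sqrt p := by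
  rw [sum_filter_pow_mul_pow_eq']
  refine norm_sum_mul_apply_add_one_le ?_
  rcases hij with h | h
  · exact Or.inl (char_pow_ne_one hζ hχ h)
  · exact Or.inr (char_pow_ne_one hζ hχ h)

/-- **`9q² · #U` as a character sum**, `U = {k ≠ 0, −1 : χ(k)³ = 1, χ(k+1)³ = −1, χ(k)^q ≠ 1, (χ(k)χ(k+1))^q = 1}`
(`q` even). [folklore] -/
private theorem nine_sq_mul_card_U (hq : Even q) :
    (9 * (q : ℂ) ^ 2) * ((univ.filter (fun k : ZMod p => k ≠ 0 ∧ k + 1 ≠ 0)).filter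
        (fun k => χ k ^ 3 = 1 ∧ χ (k + 1) ^ 3 = -1 ∧ χ k ^ q ≠ 1 ∧ (χ k * χ (k + 1)) ^ q = 1)).card =
      ∑ k ∈ univ.filter (fun k : ZMod p => k ≠ 0 ∧ k + 1 ≠ 0),
        (∑ a ∈ range q, χ k ^ (3 * a)) * (∑ b ∈ range q, (-1) ^ b * χ (k + 1) ^ (3 * b)) *
          (2 - χ k ^ q - χ k ^ (2 * q)) * (1 + (χ k * χ (k + 1)) ^ q + (χ k * χ (k + 1)) ^ (2 * q)) := by
  classical
  rw [Finset.sum_congr rfl (fun k hk => by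
    simp only [mem_filter, mem_univ, true_and] at hk
    exact weight_eq_ite hq (apply_pow_order hg hζ hχ hk.1) (apply_pow_order hg hζ hχ hk.2))]
  rw [← Finset.sum_filter, Finset.sum_const, nsmul_eq_mul, mul_comm]

omit hg hζ hχ in
/-- The only index `(a, b, c, d)` with `a, b < q`, `c, d < 3` whose monomial `χ(k)^{3a + q(c+d)} χ(k+1)^{3b + qd}`
is trivial (both exponents divisible by `3q`) is `0` — for `q` prime to `3`. [folklore] -/
private theorem index_eq_zero_of_dvd (hq3 : Nat.Coprime 3 q) {a b c d : ℕ} (ha : a < q) (hb : b < q)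
    (hc : c < 3) (hd : d < 3) (h1 : 3 * q ∣ 3 * a + q * (c + d)) (h2 : 3 * q ∣ 3 * b + q * d) :
    a = 0 ∧ b = 0 ∧ c = 0 ∧ d = 0 := by
  -- `d = 0`
  have h3d : 3 ∣ q * d := by
    have : 3 ∣ 3 * b + q * d := dvd_trans (Dvd.intro q rfl) h2
    exact (Nat.dvd_add_right (Dvd.intro b rfl)).1 this
  have hd0 : d = 0 := by
    have : 3 ∣ d := hq3.dvd_of_dvd_mul_left h3d
    omega
  subst hd0
  -- `b = 0`
  have hb0 : b = 0 := by
    rw [mul_zero, add_zero] at h2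
    have : q ∣ b := Nat.dvd_of_mul_dvd_mul_left (by norm_num : 0 < 3) h2
    rcases this with ⟨e, rfl⟩
    rcases Nat.eq_zero_or_pos e with rfl | he
    · simp
    · exfalso
      have : q * 1 ≤ q * e := Nat.mul_le_mul_left q he
      omega
  -- `c = 0`
  have h3c : 3 ∣ q * c := by
    rw [add_zero] at h1
    have : 3 ∣ 3 * a + q * c := dvd_trans (Dvd.intro q rfl) h1
    exact (Nat.dvd_add_right (Dvd.intro a rfl)).1 this
  have hc0 : c = 0 := by
    have : 3 ∣ c := hq3.dvd_of_dvd_mul_left h3c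
    omega
  subst hc0
  have ha0 : a = 0 := by
    rw [add_zero, mul_zero, add_zero] at h1
    have : q ∣ a := Nat.dvd_of_mul_dvd_mul_left (by norm_num : 0 < 3) h1
    rcases this with ⟨e, rfl⟩
    rcases Nat.eq_zero_or_pos e with rfl | he
    · simp
    · exfalso
      have : q * 1 ≤ q * e := Nat.mul_le_mul_left q he
      omega
  exact ⟨ha0, hb0, rfl, rfl⟩

/-- **The main count: `9q² · #U ≥ 2(p − 2) − 12q²√p`** — expand the weight into the `9q²` monomials
`(−1)^b e_c · χ(k)^{3a + q(c+d)} χ(k+1)^{3b + qd}` (`e = (2, −1, −1)`); the trivial one (`a = b = c = d = 0`,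
coefficient `2`) contributes `2(p − 2)`, the others are Weil-bounded pair sums with `Σ |coeff| ≤ 12q²`.
[cite: FiteShparlinski2016, §3 (proof of Thm. 1)] -/
theorem card_U_ge_of_order (hq : Even q) (hq3 : Nat.Coprime 3 q) (hq0 : 0 < q) :
    (2 * ((p : ℝ) - 2) - 12 * (q : ℝ) ^ 2 * Real.sqrt p) / (9 * (q : ℝ) ^ 2) ≤
      (((univ.filter (fun k : ZMod p => k ≠ 0 ∧ k + 1 ≠ 0)).filter
        (fun k => χ k ^ 3 = 1 ∧ χ (k + 1) ^ 3 = -1 ∧ χ k ^ q ≠ 1 ∧ (χ k * χ (k + 1)) ^ q = 1)).card : ℝ) := by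
  classical
  set F' := univ.filter (fun k : ZMod p => k ≠ 0 ∧ k + 1 ≠ 0) with hF'
  set T : ℕ → ℕ → ℂ := fun i j => ∑ k ∈ F', χ k ^ i * χ (k + 1) ^ j with hT
  set N := ((F'.filter
        (fun k => χ k ^ 3 = 1 ∧ χ (k + 1) ^ 3 = -1 ∧ χ k ^ q ≠ 1 ∧ (χ k * χ (k + 1)) ^ q = 1)).card) with hN
  -- index set (`x = (((a, b), c), d)`), coefficients, exponents
  set I : Finset (((ℕ × ℕ) × ℕ) × ℕ) := ((range q ×ˢ range q) ×ˢ range 3) ×ˢ range 3 with hI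
  set e : ℕ → ℂ := fun c => if c = 0 then 2 else -1 with he
  set cf : ((ℕ × ℕ) × ℕ) × ℕ → ℂ := fun x => (-1) ^ x.1.1.2 * e x.1.2 with hcf
  set e1 : ((ℕ × ℕ) × ℕ) × ℕ → ℕ := fun x => 3 * x.1.1.1 + q * (x.1.2 + x.2) with he1
  set e2 : ((ℕ × ℕ) × ℕ) × ℕ → ℕ := fun x => 3 * x.1.1.2 + q * x.2 with he2
  -- pointwise expansion of the weight
  have hW : ∀ u w : ℂ,
      (∑ a ∈ range q, u ^ (3 * a)) * (∑ b ∈ range q, (-1) ^ b * w ^ (3 * b)) * (2 - u ^ q - u ^ (2 * q)) *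
          (1 + (u * w) ^ q + (u * w) ^ (2 * q)) =
        ∑ x ∈ I, cf x * (u ^ e1 x * w ^ e2 x) := by
    intro u w
    have hC : (2 : ℂ) - u ^ q - u ^ (2 * q) = ∑ c ∈ range 3, e c * u ^ (q * c) := by
      simp only [he, Finset.sum_range_succ, Finset.sum_range_zero]
      norm_num
      ring
    have hD : (1 : ℂ) + (u * w) ^ q + (u * w) ^ (2 * q) = ∑ d ∈ range 3, (u * w) ^ (q * d) := by
      simp only [Finset.sum_range_succ, Finset.sum_range_zero]
      ring
    rw [hC, hD, Finset.sum_mul_sum, ← Finset.sum_product', Finset.sum_mul_sum, ← Finset.sum_product',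
      Finset.sum_mul_sum, ← Finset.sum_product']
    refine Finset.sum_congr rfl fun x _ => ?_
    simp only [hcf, he1, he2]
    ring
  -- the character sum, expanded
  have hid := nine_sq_mul_card_U hg hζ hχ hq
  rw [← hF', ← hN] at hid
  have hexp : ∑ k ∈ F', (∑ a ∈ range q, χ k ^ (3 * a)) * (∑ b ∈ range q, (-1) ^ b * χ (k + 1) ^ (3 * b)) *
      (2 - χ k ^ q - χ k ^ (2 * q)) * (1 + (χ k * χ (k + 1)) ^ q + (χ k * χ (k + 1)) ^ (2 * q)) =
      ∑ x ∈ I, cf x * T (e1 x) (e2 x) := by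
    rw [Finset.sum_congr rfl (fun k _ => hW (χ k) (χ (k + 1))), Finset.sum_comm]
    refine Finset.sum_congr rfl fun x _ => ?_
    rw [hT, Finset.mul_sum]
  rw [hexp] at hid
  -- isolate the trivial monomial
  have h0mem : ((((0, 0), 0), 0) : ((ℕ × ℕ) × ℕ) × ℕ) ∈ I := by
    simp [hI, hq0]
  rw [← Finset.add_sum_erase _ _ h0mem] at hid
  have h00 : cf (((0, 0), 0), 0) * T (e1 (((0, 0), 0), 0)) (e2 (((0, 0), 0), 0)) = 2 * ((p : ℂ) - 2) := by
    simp only [hcf, he, he1, he2, hT, pow_zero, mul_zero, add_zero, mul_one, one_mul, Finset.sum_const,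
      nsmul_eq_mul, if_true]
    rw [hF', card_filter_ne_zero_ne_neg_one', Nat.cast_sub hp.out.two_le]
    norm_num
  rw [h00] at hid
  set S := ∑ x ∈ I.erase (((0, 0), 0), 0), cf x * T (e1 x) (e2 x) with hS
  -- every other monomial is Weil-bounded
  have hbound : ∀ x ∈ I.erase ((((0, 0), 0), 0) : ((ℕ × ℕ) × ℕ) × ℕ),
      ‖cf x * T (e1 x) (e2 x)‖ ≤ ‖cf x‖ * Real.sqrt p := by
    intro x hx
    rw [norm_mul]
    refine mul_le_mul_of_nonneg_left ?_ (norm_nonneg _)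
    refine norm_sum_filter_pow_mul_pow_le_of_not_dvd hζ hχ ?_
    simp only [hI, mem_erase, mem_product, mem_range, ne_eq] at hx
    obtain ⟨hne, ⟨⟨ha, hb⟩, hc⟩, hd⟩ := hx
    by_contra hdiv
    rw [not_or, not_not, not_not] at hdiv
    obtain ⟨h1, h2, h3, h4⟩ := index_eq_zero_of_dvd hq3 ha hb hc hd hdiv.1 hdiv.2
    exact hne (Prod.ext (Prod.ext (Prod.ext h1 h2) h3) h4)
  -- the sum of the absolute values of all coefficients is `12 q²`
  have hcoef : ∑ x ∈ I, ‖cf x‖ = 12 * (q : ℝ) ^ 2 := by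
    have hnorm : ∀ x : ((ℕ × ℕ) × ℕ) × ℕ, ‖cf x‖ = ‖e x.1.2‖ := by
      intro x
      simp only [hcf, norm_mul, norm_pow, norm_neg, norm_one, one_pow, one_mul]
    simp_rw [hnorm]
    rw [hI, Finset.sum_product, Finset.sum_product, Finset.sum_product]
    simp only [Finset.sum_const, Finset.card_range, Finset.sum_range_succ, Finset.sum_range_zero, he]
    norm_num
    ring
  have hS_le : ‖S‖ ≤ 12 * (q : ℝ) ^ 2 * Real.sqrt p := by
    calc ‖S‖ ≤ ∑ x ∈ I.erase (((0, 0), 0), 0), ‖cf x * T (e1 x) (e2 x)‖ := norm_sum_le _ _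
      _ ≤ ∑ x ∈ I.erase (((0, 0), 0), 0), ‖cf x‖ * Real.sqrt p := Finset.sum_le_sum hbound
      _ ≤ ∑ x ∈ I, ‖cf x‖ * Real.sqrt p := by
          refine Finset.sum_le_sum_of_subset_of_nonneg (Finset.erase_subset _ _) fun x _ _ => ?_
          exact mul_nonneg (norm_nonneg _) (Real.sqrt_nonneg _)
      _ = 12 * (q : ℝ) ^ 2 * Real.sqrt p := by rw [← Finset.sum_mul, hcoef]
  -- real parts
  have hre := congr_arg Complex.re hid
  simp only [Complex.mul_re, Complex.add_re, Complex.sub_re, Complex.natCast_re, Complex.natCast_im,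
    Complex.re_ofNat, Complex.im_ofNat, mul_zero, sub_zero] at hre
  have hSre : -(12 * (q : ℝ) ^ 2 * Real.sqrt p) ≤ S.re :=
    (neg_le_neg hS_le).trans (neg_le.1 ((neg_le_abs _).trans (Complex.abs_re_le_norm S)))
  have hq2 : (0 : ℝ) < 9 * (q : ℝ) ^ 2 := by positivity
  rw [div_le_iff₀ hq2]
  have hpow : ((q : ℂ) ^ 2).re = (q : ℝ) ^ 2 := by
    rw [← Complex.ofReal_natCast, ← Complex.ofReal_pow, Complex.ofReal_re]
  have hpow' : ((q : ℂ) ^ 2).im = 0 := by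
    rw [← Complex.ofReal_natCast, ← Complex.ofReal_pow, Complex.ofReal_im]
  rw [hpow, hpow'] at hre
  nlinarith [hre, hSre]

end Counting

/-! ## §5 From the character conditions to the power-residue conditions -/

section Dictionary

variable {p : ℕ} [hp : Fact p.Prime]
variable {g : (ZMod p)ˣ} {ζ : ℂ} {χ : MulChar (ZMod p) ℂ} {q : ℕ}
variable (hg : ∀ x : (ZMod p)ˣ, x ∈ Subgroup.zpowers g) (hζ : IsPrimitiveRoot ζ (3 * q)) (hχ : χ g = ζ)
include hg hζ hχ

omit hg hζ hχ in
/-- `y² = 1` and `y ≠ 1` force `y = −1` (in a domain). [folklore] -/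
private theorem eq_neg_one_of_sq {R : Type*} [CommRing R] [NoZeroDivisors R] {y : R} (h : y ^ 2 = 1)
    (h1 : y ≠ 1) : y = -1 := by
  have hfac : (y - 1) * (y + 1) = 0 := by linear_combination h
  rcases mul_eq_zero.1 hfac with h2 | h2
  · exact absurd (by linear_combination h2 : y = 1) h1
  · linear_combination h2

/-- **The elements of `U` satisfy the power-residue conditions of §2**: for a character `χ` of order `3q`
(`q` even, `3q ∣ p − 1`), `χ(k)³ = 1`, `χ(k+1)³ = −1`, `χ(k)^q ≠ 1`, `(χ(k)χ(k+1))^q = 1` translate into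
`k^{(p−1)/q} = 1`, `(k+1)^{(p−1)/q} = −1`, `k^{(p−1)/3} ≠ 1`, `(k(k+1))^{(p−1)/3} = 1` (the character
expansion (2.1) of the conditions «`ord u ∣ (ℓ−1)/2^α`», «`ν₃(ord u) = h`» of §3, read backwards).
[cite: FiteShparlinski2016, §2 (2.1) and §3 (proof of Thm. 1)] -/
theorem power_residue_conditions_of_char (hq : Even q) (hq0 : 0 < q) (hn : 3 * q ∣ p - 1) {k : ZMod p}
    (hk : k ≠ 0) (hk1 : k + 1 ≠ 0) (hu3 : χ k ^ 3 = 1) (hw3 : χ (k + 1) ^ 3 = -1) (huq : χ k ^ q ≠ 1)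
    (huw : (χ k * χ (k + 1)) ^ q = 1) :
    k ^ ((p - 1) / q) = 1 ∧ (k + 1) ^ ((p - 1) / q) = -1 ∧ k ^ ((p - 1) / 3) ≠ 1 ∧
      (k * (k + 1)) ^ ((p - 1) / 3) = 1 := by
  have h3q : 3 * q / q = 3 := by rw [Nat.mul_div_cancel _ hq0]
  have hq3 : 3 * q / 3 = q := by rw [Nat.mul_div_cancel_left _ (by norm_num : 0 < 3)]
  obtain ⟨r, hr⟩ := hq
  have hr0 : 0 < r := by omega
  have hqr : q = 2 * r := by omega
  have h6 : 3 * q / r = 6 := by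
    rw [hqr, show 3 * (2 * r) = 6 * r by ring, Nat.mul_div_cancel _ hr0]
  -- `χ(k)³ = 1 ↔ k^{(p−1)/q} = 1`
  have e1 := apply_pow_div_eq_one_iff hg hζ hχ hn (d := q) (Dvd.intro_left 3 rfl) hq0 hk
  rw [h3q] at e1
  -- `χ(k+1)⁶ = 1 ↔ (k+1)^{(p−1)/r} = 1` and `χ(k+1)³ = 1 ↔ (k+1)^{(p−1)/q} = 1`
  have e2 := apply_pow_div_eq_one_iff hg hζ hχ hn (d := r) ⟨6, by rw [hqr]; ring⟩ hr0 hk1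
  rw [h6] at e2
  have e3 := apply_pow_div_eq_one_iff hg hζ hχ hn (d := q) (Dvd.intro_left 3 rfl) hq0 hk1
  rw [h3q] at e3
  -- `χ(x)^q = 1 ↔ x^{(p−1)/3} = 1`
  have e4 := apply_pow_div_eq_one_iff hg hζ hχ hn (d := 3) (Dvd.intro q rfl) (by norm_num) hk
  rw [hq3] at e4
  have e5 := apply_pow_div_eq_one_iff hg hζ hχ hn (d := 3) (Dvd.intro q rfl) (by norm_num) (mul_ne_zero hk hk1)
  rw [hq3] at e5
  refine ⟨e1.1 hu3, ?_, fun h => huq (e4.2 h), e5.1 (by rw [map_mul]; exact huw)⟩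
  -- the second condition
  have hsq : (k + 1) ^ ((p - 1) / r) = 1 := e2.1 (by rw [show (6 : ℕ) = 3 * 2 by norm_num, pow_mul, hw3]; norm_num)
  have hne : (k + 1) ^ ((p - 1) / q) ≠ 1 := fun h => by
    have := e3.2 h
    rw [this] at hw3
    norm_num at hw3
  refine eq_neg_one_of_sq ?_ hne
  rw [← pow_mul]
  have hdiv : (p - 1) / q * 2 = (p - 1) / r := by
    obtain ⟨t, ht⟩ := hn
    rw [ht, hqr, show 3 * (2 * r) * t = (2 * r) * (3 * t) by ring, Nat.mul_div_cancel_left _ (by omega),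
      show 2 * r * (3 * t) = r * (6 * t) by ring, Nat.mul_div_cancel_left _ hr0]
    ring
  rw [hdiv, hsq]

end Dictionary

/-! ## §6 Fité–Shparlinski's Corollary 2 -/

section CorollaryTwo

variable {p : ℕ} [hp : Fact p.Prime] (L : Type) [Field L] [NumberField L] [IsCyclotomicExtension {p} ℚ L]

omit hp in
/-- In a set of residues at most two elements have order `3` (they are roots of `X² + X + 1`). [folklore] -/
private theorem card_filter_orderOf_eq_three_le_two [Fact p.Prime] (s : Finset (ZMod p)) :
    (s.filter (fun k => orderOf k = 3)).card ≤ 2 := by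
  classical
  set E := s.filter (fun k => orderOf k = 3) with hE
  have hroot : ∀ k ∈ E, k ^ 2 + k + 1 = 0 := by
    intro k hk
    simp only [hE, mem_filter] at hk
    have h3 : k ^ 3 = 1 := by rw [← hk.2]; exact pow_orderOf_eq_one k
    have h1 : k ≠ 1 := by
      rintro rfl
      have := hk.2
      rw [orderOf_one] at this
      norm_num at this
    have hfac : (k - 1) * (k ^ 2 + k + 1) = 0 := by linear_combination h3
    exact (mul_eq_zero.1 hfac).resolve_left (sub_ne_zero.2 h1)
  rcases E.eq_empty_or_nonempty with h | ⟨x₀, hx₀⟩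
  · rw [h]; simp
  · have hsub : E ⊆ {x₀, -1 - x₀} := by
      intro y hy
      have hx := hroot x₀ hx₀
      have hyr := hroot y hy
      have hfac : (y - x₀) * (y + x₀ + 1) = 0 := by linear_combination hyr - hx
      simp only [mem_insert, mem_singleton]
      rcases mul_eq_zero.1 hfac with h | h
      · exact Or.inl (by linear_combination h)
      · exact Or.inr (by linear_combination h)
    exact (Finset.card_le_card hsub).trans Finset.card_le_two

omit hp in
/-- A set of residues with at least three elements contains one of order `≠ 3`. [folklore] -/
private theorem exists_orderOf_ne_three_of_three_le_card [Fact p.Prime] {s : Finset (ZMod p)} (hs : 3 ≤ s.card) :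
    ∃ k ∈ s, orderOf k ≠ 3 := by
  classical
  by_contra hno
  push Not at hno
  have hsub : s ⊆ s.filter (fun k => orderOf k = 3) := fun k hk => mem_filter.2 ⟨hk, hno k hk⟩
  have := (Finset.card_le_card hsub).trans (card_filter_orderOf_eq_three_le_two s)
  omega

/-- **The one-sided count (the main term of Fité–Shparlinski's Theorem 1 for `r = β`): for a prime `p` with
`3 ∣ p − 1` and `2^α ‖ p − 1`, the number of `k ≠ 0, −1` with `ord k ≠ 3` satisfying (ii), (iii) of Lemma 6 —
`ord k`, `ord(−k²−k)` odd, `v₃(ord(−k²−k)) < v₃(ord k)`, i.e. `k ∈ K_p` by [FGL] Thm. 4.10 (tree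
`isNondegenerate_fermat_iff_orderOf`) — is at least `(2(p−2) − 12·4^α √p)/(9·4^α) − 2`.**  Proof: with ONE
character `χ` of order `3 · 2^α` (a generator `g ↦ e^{2πi/(3·2^α)}`), the set `U` of §4 has
`9q² · #U ≥ 2(p−2) − 12q²√p` (`q = 2^α`), its elements satisfy the conditions by §2 and §5, and at most two
of them have order `3`.  ([FS] Thm. 1: `|#K_ℓ − ℓ(1 − 3^{−2β})/2^{2α+2}| ≤ 4β²√ℓ + 33/16`; for `β = 1` the main
terms agree: `2/(9·4^α) = (1 − 1/9)/2^{2α+2}`.) [cite: FiteShparlinski2016, Thm. 1 and §3 (proof)] -/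
theorem card_filter_lemma6_ge {α : ℕ} (hα : 2 ^ α ∣ p - 1) (hodd : Odd ((p - 1) / 2 ^ α)) (h3 : 3 ∣ p - 1) :
    (2 * ((p : ℝ) - 2) - 12 * 4 ^ α * Real.sqrt p) / (9 * 4 ^ α) - 2 ≤
      (((univ.filter (fun k : ZMod p => k ≠ 0 ∧ k + 1 ≠ 0)).filter (fun k => orderOf k ≠ 3 ∧
          Odd (orderOf (-k ^ 2 - k)) ∧ Odd (orderOf k) ∧
          padicValNat 3 (orderOf (-k ^ 2 - k)) < padicValNat 3 (orderOf k))).card : ℝ) := by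
  classical
  -- `α ≥ 1`: `p` is odd (as `3 ∣ p − 1` forces `p ≠ 2`) and `(p − 1)/2^α` is odd
  have hp2 : p ≠ 2 := by rintro rfl; norm_num at h3
  have hα1 : 1 ≤ α := by
    by_contra h
    have hα0 : α = 0 := by omega
    rw [hα0, pow_zero, Nat.div_one] at hodd
    have := hp.out.odd_of_ne_two hp2
    obtain ⟨r, hr⟩ := this
    obtain ⟨s, hs⟩ := hodd
    omega
  obtain ⟨q, hqdef⟩ : ∃ q : ℕ, q = 2 ^ α := ⟨_, rfl⟩
  rw [← hqdef] at hα hodd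
  have hq0 : 0 < q := by rw [hqdef]; positivity
  have hqeven : Even q := by
    rw [hqdef, show α = (α - 1) + 1 by omega, pow_succ]
    exact even_two.mul_left _
  have hq3 : Nat.Coprime 3 q := by
    rw [hqdef]
    exact Nat.Coprime.pow_right _ (by norm_num)
  have hn : 3 * q ∣ p - 1 := hq3.mul_dvd_of_dvd_of_dvd h3 hα
  -- a generator and the character `g ↦ ζ_{3q}`
  obtain ⟨g, hg⟩ := IsCyclic.exists_generator (α := (ZMod p)ˣ)
  have h3q0 : 3 * q ≠ 0 := by positivity
  have hζ : IsPrimitiveRoot (Complex.exp (2 * Real.pi * Complex.I / ((3 * q : ℕ) : ℂ))) (3 * q) :=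
    Complex.isPrimitiveRoot_exp (3 * q) h3q0
  set ζ : ℂ := Complex.exp (2 * Real.pi * Complex.I / ((3 * q : ℕ) : ℂ)) with hζdef
  have hζunit : IsUnit ζ := hζ.isUnit h3q0
  have hζmem : hζunit.unit ∈ rootsOfUnity (Fintype.card (ZMod p)ˣ) ℂ := by
    rw [mem_rootsOfUnity, ZMod.card_units, Units.ext_iff, Units.val_pow_eq_pow_val, IsUnit.unit_spec,
      Units.val_one]
    exact (hζ.pow_eq_one_iff_dvd _).2 hn
  set χ : MulChar (ZMod p) ℂ := MulChar.ofRootOfUnity hζmem hg with hχdef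
  have hχ : χ g = ζ := by
    have h := MulChar.ofRootOfUnity_spec hζmem hg
    rw [← hχdef] at h
    rw [h, IsUnit.unit_spec]
  -- the sets `U` and `K'`
  set U := (univ.filter (fun k : ZMod p => k ≠ 0 ∧ k + 1 ≠ 0)).filter
        (fun k => χ k ^ 3 = 1 ∧ χ (k + 1) ^ 3 = -1 ∧ χ k ^ q ≠ 1 ∧ (χ k * χ (k + 1)) ^ q = 1) with hU
  set K' := (univ.filter (fun k : ZMod p => k ≠ 0 ∧ k + 1 ≠ 0)).filter (fun k => orderOf k ≠ 3 ∧
          Odd (orderOf (-k ^ 2 - k)) ∧ Odd (orderOf k) ∧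
          padicValNat 3 (orderOf (-k ^ 2 - k)) < padicValNat 3 (orderOf k)) with hK'
  have hcount := card_U_ge_of_order hg hζ hχ hqeven hq3 hq0
  rw [← hU] at hcount
  -- `U ∖ {cube roots of 1} ⊆ K'`
  have hsub : U.filter (fun k => orderOf k ≠ 3) ⊆ K' := by
    intro k hk
    simp only [hU, mem_filter, mem_univ, true_and] at hk
    obtain ⟨⟨⟨hk0, hk1⟩, hu3, hw3, huq, huw⟩, hk3⟩ := hk
    obtain ⟨c1, c2, c3, c4⟩ := power_residue_conditions_of_char hg hζ hχ hqeven hq0 hn hk0 hk1 hu3 hw3 huq huw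
    have hdeg := degenerate_of_power_residue_conditions hα hodd h3 hk0 hk1 c1 c2 c3 c4
    simp only [hK', mem_filter, mem_univ, true_and]
    exact ⟨⟨hk0, hk1⟩, hk3, hdeg.1, hdeg.2.1, hdeg.2.2⟩
  have hsplit := Finset.card_filter_add_card_filter_not (s := U) (fun k => orderOf k ≠ 3)
  have h2 : (U.filter (fun k => ¬ orderOf k ≠ 3)).card ≤ 2 := by
    have : U.filter (fun k => ¬ orderOf k ≠ 3) = U.filter (fun k => orderOf k = 3) :=
      Finset.filter_congr (fun k _ => not_not)
    rw [this]
    exact card_filter_orderOf_eq_three_le_two U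
  have h1 := Finset.card_le_card hsub
  have hq2 : (4 : ℝ) ^ α = (q : ℝ) ^ 2 := by
    rw [hqdef]
    push_cast
    rw [← pow_mul, mul_comm, pow_mul]
    norm_num
  rw [hq2]
  have hcast : ((U.filter (fun k => orderOf k ≠ 3)).card : ℝ) + ((U.filter (fun k => ¬ orderOf k ≠ 3)).card : ℝ)
      = (U.card : ℝ) := by exact_mod_cast hsplit
  have h1' : ((U.filter (fun k => orderOf k ≠ 3)).card : ℝ) ≤ (K'.card : ℝ) := by exact_mod_cast h1
  have h2' : ((U.filter (fun k => ¬ orderOf k ≠ 3)).card : ℝ) ≤ 2 := by exact_mod_cast h2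
  linarith

/-- **Fité–Shparlinski's Corollary 2, in `2`-adic form and with the threshold `441 · 2^{4α}`**: let `p` be a prime
with `3 ∣ p − 1`, and let `2^α ‖ p − 1` (i.e. `2^α ∣ p − 1` with odd cofactor).  If `p > 441 · 2^{4α}` then
`K_p ≠ ∅`: some Fermat CM type `Φ_{S_k}` of the `p`-th cyclotomic field (`k ≠ 0, −1`, `ord k ≠ 3`) is
DEGENERATE (`√p > 21 · 4^α` makes the bound of `card_filter_lemma6_ge` positive).
[cite: FiteShparlinski2016, Cor. 2] -/
theorem exists_not_isNondegenerate_fermat_of_two_pow_dvd {α : ℕ} (hα : 2 ^ α ∣ p - 1)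
    (hodd : Odd ((p - 1) / 2 ^ α)) (h3 : 3 ∣ p - 1) (hbig : 441 * 2 ^ (4 * α) < p) :
    ∃ a : ZMod p, ∃ (ha : a ≠ 0) (ha1 : 1 + a ≠ 0), orderOf a ≠ 3 ∧
      ¬ IsNondegenerate (cmTypeOfResidues (L := L) (fermatCMType p 1 a (-1 - a)) (fermatCMType_one_cm ha ha1)) := by
  classical
  have hK := card_filter_lemma6_ge (p := p) hα hodd h3
  set K' := (univ.filter (fun k : ZMod p => k ≠ 0 ∧ k + 1 ≠ 0)).filter (fun k => orderOf k ≠ 3 ∧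
          Odd (orderOf (-k ^ 2 - k)) ∧ Odd (orderOf k) ∧
          padicValNat 3 (orderOf (-k ^ 2 - k)) < padicValNat 3 (orderOf k)) with hK'def
  -- the bound is positive: `√p > 21 Q`, `Q = 4^α`
  set Q : ℝ := (4 : ℝ) ^ α with hQ
  have hQ1 : (1 : ℝ) ≤ Q := one_le_pow₀ (by norm_num)
  have hQpos : (0 : ℝ) < Q := by positivity
  have hss : Real.sqrt (p : ℝ) * Real.sqrt p = p := Real.mul_self_sqrt (Nat.cast_nonneg p)
  have hQ2 : (2 : ℝ) ^ (4 * α) = Q ^ 2 := by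
    rw [hQ, ← pow_mul, show (4 : ℝ) = 2 ^ 2 by norm_num, ← pow_mul]
    ring_nf
  have hbig' : (441 : ℝ) * Q ^ 2 < p := by
    rw [← hQ2]; exact_mod_cast hbig
  have hsqrt : (21 : ℝ) * Q < Real.sqrt p := by
    have h1 : (21 : ℝ) * Q = Real.sqrt ((21 * Q) ^ 2) := by
      rw [Real.sqrt_sq (by positivity)]
    rw [h1]
    exact Real.sqrt_lt_sqrt (by positivity) (by nlinarith)
  have hs_pos : (0 : ℝ) < Real.sqrt p := lt_trans (by positivity) hsqrt
  have i1 : 21 * Q * Real.sqrt p < Real.sqrt p * Real.sqrt p := mul_lt_mul_of_pos_right hsqrt hs_pos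
  have i2 : 21 * Q * (30 * Q) < Real.sqrt p * (30 * Q) := mul_lt_mul_of_pos_right hsqrt (by positivity)
  have i3 : (1 : ℝ) * Q ≤ Q * Q := mul_le_mul_of_nonneg_right hQ1 hQpos.le
  rw [hss] at i1
  have h9 : (0 : ℝ) < 9 * Q := by positivity
  have hpos : (0 : ℝ) < (2 * ((p : ℝ) - 2) - 12 * Q * Real.sqrt p) / (9 * Q) - 2 := by
    rw [sub_pos, lt_div_iff₀ h9]
    nlinarith [i1, i2, i3, hQ1]
  have hcard : 0 < K'.card := by
    have : (0 : ℝ) < (K'.card : ℝ) := lt_of_lt_of_le hpos hK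
    exact_mod_cast this
  obtain ⟨k, hk⟩ := Finset.card_pos.1 hcard
  simp only [hK'def, mem_filter, mem_univ, true_and] at hk
  obtain ⟨⟨hk0, hk1⟩, hk3, ho1, ho2, hv⟩ := hk
  have hk1' : 1 + k ≠ 0 := by rwa [add_comm]
  refine ⟨k, hk0, hk1', hk3, ?_⟩
  rw [isNondegenerate_fermat_iff_orderOf L hk0 hk1', not_not]
  exact ⟨ho1, ho2, hv⟩

/-- **Fité–Shparlinski 2016, COROLLARY 2 (as printed).** «Let `ℓ − 1 = 2^α 3^β m` for some integers `α, β > 0`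
and `m` with `gcd(m, 6) = 1`.  If `ℓ > 441 · 2^{4α} β⁴` then `#K_ℓ > 0`.»  Here `k ∈ K_ℓ` («`D_{k,ℓ}` is
singular», Lemma 6) is: `k ≠ 0, −1`, `ord k ≠ 3` and the Fermat CM type `Φ_{S_k}` of the `ℓ`-th cyclotomic
field is degenerate.  (In fact `ℓ > 441 · 2^{4α}` suffices: `exists_not_isNondegenerate_fermat_of_two_pow_dvd`.)
[cite: FiteShparlinski2016, Cor. 2] -/
theorem fiteShparlinski_cor_2 {α β m : ℕ} (hℓ : p - 1 = 2 ^ α * 3 ^ β * m) (hα : 0 < α) (hβ : 0 < β)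
    (hm : Nat.Coprime m 6) (hbig : 441 * 2 ^ (4 * α) * β ^ 4 < p) :
    ∃ a : ZMod p, ∃ (ha : a ≠ 0) (ha1 : 1 + a ≠ 0), orderOf a ≠ 3 ∧
      ¬ IsNondegenerate (cmTypeOfResidues (L := L) (fermatCMType p 1 a (-1 - a)) (fermatCMType_one_cm ha ha1)) := by
  have _hα := hα
  have hdvd : 2 ^ α ∣ p - 1 := ⟨3 ^ β * m, by rw [hℓ]; ring⟩
  have hcof : (p - 1) / 2 ^ α = 3 ^ β * m := by
    rw [hℓ, mul_assoc, Nat.mul_div_cancel_left _ (by positivity)]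
  have hmodd : Odd m := by
    have h2 : Nat.Coprime m 2 := Nat.Coprime.coprime_dvd_right (by norm_num : 2 ∣ 6) hm
    exact Nat.coprime_two_right.mp h2
  have hodd : Odd ((p - 1) / 2 ^ α) := by
    rw [hcof]
    exact (Odd.pow (by decide : Odd 3)).mul hmodd
  have h3 : 3 ∣ p - 1 := by
    rw [hℓ, show β = (β - 1) + 1 by omega, pow_succ]
    exact ⟨2 ^ α * 3 ^ (β - 1) * m, by ring⟩
  refine exists_not_isNondegenerate_fermat_of_two_pow_dvd L hdvd hodd h3 (lt_of_le_of_lt ?_ hbig)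
  have hβ4 : 1 ≤ β ^ 4 := Nat.one_le_pow _ _ hβ
  calc 441 * 2 ^ (4 * α) = 441 * 2 ^ (4 * α) * 1 := by ring
    _ ≤ 441 * 2 ^ (4 * α) * β ^ 4 := Nat.mul_le_mul_left _ hβ4

/-- **The case `α = 2`**: every prime `p ≡ 13 (mod 24)` (`4 ‖ p − 1`, `3 ∣ p − 1`) with `p > 112896 = 441 · 2⁸`
has `K_p ≠ ∅` (the first case beyond Lenstra's `p ≡ 7 (mod 12)` = `α = 1`, tree
`exists_not_isNondegenerate_fermat_of_gt_103`). [cite: FiteShparlinski2016, Cor. 2] -/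
theorem exists_not_isNondegenerate_fermat_of_mod_24 (h24 : p % 24 = 13) (hbig : 112896 < p) :
    ∃ a : ZMod p, ∃ (ha : a ≠ 0) (ha1 : 1 + a ≠ 0), orderOf a ≠ 3 ∧
      ¬ IsNondegenerate (cmTypeOfResidues (L := L) (fermatCMType p 1 a (-1 - a)) (fermatCMType_one_cm ha ha1)) := by
  have h4 : 2 ^ 2 ∣ p - 1 := ⟨(p - 1) / 4, by omega⟩
  have hodd : Odd ((p - 1) / 2 ^ 2) := by
    rw [Nat.odd_iff]
    omega
  have h3 : 3 ∣ p - 1 := by omega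
  exact exists_not_isNondegenerate_fermat_of_two_pow_dvd L h4 hodd h3 (by norm_num; omega)

end CorollaryTwo

/-! ## §7 On abelian varieties: degenerate simple CM factors of `J(F_p)` above the threshold -/

section Hodge

open NumberField CategoryTheory CategoryTheory.Limits
open Literature.AlgebraicGeometry.Motives (AbelianVariety)
open Literature.AlgebraicGeometry.HodgeTheory
open Literature.Barriers.HodgeConjecture (divisorClassesSpan)

variable {p : ℕ} [hp : Fact p.Prime] (L : Type) [Field L] [NumberField L] [IsCyclotomicExtension {p} ℚ L]

/-- `ℚ(ζ_p)` is a CM field for an odd prime `p` (Mathlib). [folklore] -/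
private theorem isCMField_cyclotomic_of_ne_two (hp2 : p ≠ 2) : IsCMField L :=
  IsCyclotomicExtension.Rat.isCMField L (S := {p})
    ⟨p, rfl, lt_of_le_of_ne hp.out.two_le (Ne.symm hp2)⟩

/-- **Corollary 2 ON ABELIAN VARIETIES.** For every prime `ℓ` with `ℓ − 1 = 2^α 3^β m`, `α, β > 0`,
`gcd(m, 6) = 1` and `ℓ > 441 · 2^{4α} β⁴` there is a Fermat CM type `Φ_{S_k}` of the `ℓ`-th cyclotomic field
(`k ≠ 0, −1`, `ord k ≠ 3`) and a SIMPLE abelian variety `B` of dimension `(ℓ−1)/2` of that type (a realisation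
exists by Shimura §6.2 Thm. 3 = tree `exists_isCMTypeRealisation`; e.g. the simple factor `Jac(C_{k,ℓ})` of the
Fermat Jacobian `J(F_ℓ)`, «the rank of the Hodge group of `Jac(C_{k,ℓ})` is not maximal») some power of which
carries a rational `(m,m)`-class outside `Dᵐ ⊗ ℂ` — an exceptional Hodge class (tree
`isSimple_and_exists_exceptional_pow_of_orderOf`). [cite: FiteShparlinski2016, Cor. 2 and Lemma 6]
[cite: FiteGonzalezLario2016, Thm. 4.10 and Lemma 3.3] [cite: Shimura1998, §6.2 Thm. 3] -/
theorem exists_isSimple_exceptional_pow_of_gt_bound {α β m : ℕ} (hℓ : p - 1 = 2 ^ α * 3 ^ β * m)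
    (hα : 0 < α) (hβ : 0 < β) (hm : Nat.Coprime m 6) (hbig : 441 * 2 ^ (4 * α) * β ^ 4 < p) :
    ∃ (a : ZMod p) (ha : a ≠ 0) (ha1 : 1 + a ≠ 0) (B : AbelianVariety ℂ) (ι' : 𝓞 L →+* End B)
      (θ' : L →+* Module.End ℂ (complexBetti B.X 1)),
      orderOf a ≠ 3 ∧
      IsCMTypeRealisation (cmTypeOfResidues (L := L) (fermatCMType p 1 a (-1 - a)) (fermatCMType_one_cm ha ha1))
          B ι' θ' ∧ B.IsSimple ∧ B.dim = (p - 1) / 2 ∧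
        ∃ n m : ℕ, ∃ c : complexBetti (⨁ fun _ : Fin n => B).X (2 * m), IsRationalClass c ∧
          IsOfHodgeType (⨁ fun _ : Fin n => B).dim (⨁ fun _ : Fin n => B).X (2 * m) m m c ∧
          c ∉ divisorClassesSpan (⨁ fun _ : Fin n => B).X (⨁ fun _ : Fin n => B).dim m := by
  haveI : NeZero p := ⟨hp.out.ne_zero⟩
  have hp2 : p ≠ 2 := by
    rintro rfl
    have h3 : 3 ∣ 2 - 1 := by
      rw [hℓ, show β = (β - 1) + 1 by omega, pow_succ]
      exact ⟨2 ^ α * 3 ^ (β - 1) * m, by ring⟩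
    norm_num at h3
  haveI := isCMField_cyclotomic_of_ne_two L hp2
  obtain ⟨a, ha, ha1, h3, hdeg⟩ := fiteShparlinski_cor_2 L hℓ hα hβ hm hbig
  rw [isNondegenerate_fermat_iff_orderOf L ha ha1, not_not] at hdeg
  obtain ⟨B, ι', θ', hB⟩ :=
    exists_isCMTypeRealisation (cmTypeOfResidues (L := L) (fermatCMType p 1 a (-1 - a)) (fermatCMType_one_cm ha ha1))
  have hex := isSimple_and_exists_exceptional_pow_of_orderOf (L := L) ha ha1 h3 ⟨hdeg.1, hdeg.2.1⟩ hdeg.2.2 hB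
  refine ⟨a, ha, ha1, B, ι', θ', h3, hB, hex.1, ?_, hex.2⟩
  have h := Motives.schemeDim_eq_holds hB.1
  rw [finrank_eq_totient p L, Nat.totient_prime hp.out] at h
  exact h

end Hodge

/-! ## §8 Counting `k` with four averaged character conditions (the general box) -/

section FourConditions

variable {p : ℕ} [hp : Fact p.Prime]
variable {g : (ZMod p)ˣ} {ζ : ℂ} {θ : MulChar (ZMod p) ℂ} {n : ℕ}

/-- The product of the four geometric sums is `N₁N₂N₃N₄` times the indicator of the four conditions
`u^{c₁} = 1`, `(uw)^{c₂} = −1`, `u^{c₃} = 1`, `(uw)^{c₄} = 1` (`N₂` even). [folklore] -/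
private theorem fourWeight_eq_ite {N₁ N₂ N₃ N₄ c₁ c₂ c₃ c₄ : ℕ} (hN₂ : Even N₂) {u w : ℂ}
    (h1 : (u ^ c₁) ^ N₁ = 1) (h2 : ((u * w) ^ c₂) ^ N₂ = 1) (h3 : (u ^ c₃) ^ N₃ = 1)
    (h4 : ((u * w) ^ c₄) ^ N₄ = 1) :
    (∑ a ∈ range N₁, u ^ (c₁ * a)) * (∑ b ∈ range N₂, (-1) ^ b * (u * w) ^ (c₂ * b)) *
        (∑ i ∈ range N₃, u ^ (c₃ * i)) * (∑ j ∈ range N₄, (u * w) ^ (c₄ * j)) =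
      if u ^ c₁ = 1 ∧ (u * w) ^ c₂ = -1 ∧ u ^ c₃ = 1 ∧ (u * w) ^ c₄ = 1
        then ((N₁ : ℂ) * N₂ * N₃ * N₄) else 0 := by
  have hA : ∑ a ∈ range N₁, u ^ (c₁ * a) = if u ^ c₁ = 1 then (N₁ : ℂ) else 0 := by
    rw [← geom_sum_eq_ite_of_pow_eq_one' h1]
    exact Finset.sum_congr rfl fun a _ => by rw [pow_mul]
  have hB : ∑ b ∈ range N₂, (-1) ^ b * (u * w) ^ (c₂ * b) = if (u * w) ^ c₂ = -1 then (N₂ : ℂ) else 0 := by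
    have h' : (-((u * w) ^ c₂)) ^ N₂ = 1 := by rw [hN₂.neg_pow]; exact h2
    have hiff : (-((u * w) ^ c₂) = 1) ↔ ((u * w) ^ c₂ = -1) := by
      constructor
      · intro h; linear_combination -h
      · intro h; rw [h, neg_neg]
    rw [← if_congr hiff rfl rfl, ← geom_sum_eq_ite_of_pow_eq_one' h']
    refine Finset.sum_congr rfl fun b _ => ?_
    rw [pow_mul, neg_pow ((u * w) ^ c₂) b]
  have hC : ∑ i ∈ range N₃, u ^ (c₃ * i) = if u ^ c₃ = 1 then (N₃ : ℂ) else 0 := by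
    rw [← geom_sum_eq_ite_of_pow_eq_one' h3]
    exact Finset.sum_congr rfl fun i _ => by rw [pow_mul]
  have hD : ∑ j ∈ range N₄, (u * w) ^ (c₄ * j) = if (u * w) ^ c₄ = 1 then (N₄ : ℂ) else 0 := by
    rw [← geom_sum_eq_ite_of_pow_eq_one' h4]
    exact Finset.sum_congr rfl fun j _ => by rw [pow_mul]
  rw [hA, hB, hC, hD]
  by_cases k1 : u ^ c₁ = 1 <;> by_cases k2 : (u * w) ^ c₂ = -1 <;> by_cases k3 : u ^ c₃ = 1 <;>
    by_cases k4 : (u * w) ^ c₄ = 1 <;> simp [k1, k2, k3, k4]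

variable (hg : ∀ x : (ZMod p)ˣ, x ∈ Subgroup.zpowers g) (hζ : IsPrimitiveRoot ζ n) (hθ : θ g = ζ)
include hg hζ hθ

/-- `N₁N₂N₃N₄ · #V` as a character sum, `V = {k ≠ 0,−1 : θ(k)^{c₁} = 1, θ(k(k+1))^{c₂} = −1, θ(k)^{c₃} = 1,
θ(k(k+1))^{c₄} = 1}` (`n ∣ cᵢNᵢ`, `N₂` even). [folklore] -/
private theorem prod_mul_card_four {N₁ N₂ N₃ N₄ c₁ c₂ c₃ c₄ : ℕ} (hN₂ : Even N₂) (hd1 : n ∣ c₁ * N₁)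
    (hd2 : n ∣ c₂ * N₂) (hd3 : n ∣ c₃ * N₃) (hd4 : n ∣ c₄ * N₄) :
    ((N₁ : ℂ) * N₂ * N₃ * N₄) * ((univ.filter (fun k : ZMod p => k ≠ 0 ∧ k + 1 ≠ 0)).filter (fun k =>
        θ k ^ c₁ = 1 ∧ (θ k * θ (k + 1)) ^ c₂ = -1 ∧ θ k ^ c₃ = 1 ∧ (θ k * θ (k + 1)) ^ c₄ = 1)).card =
      ∑ k ∈ univ.filter (fun k : ZMod p => k ≠ 0 ∧ k + 1 ≠ 0),
        (∑ a ∈ range N₁, θ k ^ (c₁ * a)) * (∑ b ∈ range N₂, (-1) ^ b * (θ k * θ (k + 1)) ^ (c₂ * b)) *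
          (∑ i ∈ range N₃, θ k ^ (c₃ * i)) * (∑ j ∈ range N₄, (θ k * θ (k + 1)) ^ (c₄ * j)) := by
  classical
  have hpow : ∀ {x : ZMod p} (c N : ℕ), x ≠ 0 → n ∣ c * N → (θ x ^ c) ^ N = 1 := by
    intro x c N hx hcN
    obtain ⟨t, ht⟩ := hcN
    rw [← pow_mul, ht, pow_mul, apply_pow_order hg hζ hθ hx, one_pow]
  rw [Finset.sum_congr rfl (fun k hk => by
    simp only [mem_filter, mem_univ, true_and] at hk
    have hkk : k * (k + 1) ≠ 0 := mul_ne_zero hk.1 hk.2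
    exact fourWeight_eq_ite hN₂ (hpow c₁ N₁ hk.1 hd1) (by rw [← map_mul]; exact hpow c₂ N₂ hkk hd2)
      (hpow c₃ N₃ hk.1 hd3) (by rw [← map_mul]; exact hpow c₄ N₄ hkk hd4))]
  rw [← Finset.sum_filter, Finset.sum_const, nsmul_eq_mul, mul_comm]

/-- **The general box count**: for a character `θ` of order `n` and four averaged conditions
`θ(k)^{c₁} = 1`, `θ(k(k+1))^{c₂} = −1`, `θ(k)^{c₃} = 1`, `θ(k(k+1))^{c₄} = 1` (periods `Nᵢ` with `n ∣ cᵢNᵢ`, `N₂`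
even) such that the ONLY tuple `(a, b, i, j)` in the box `[0,N₁)×[0,N₂)×[0,N₃)×[0,N₄)` with both exponents
`c₁a + c₂b + c₃i + c₄j` and `c₂b + c₄j` divisible by `n` is `0`, the number of such `k ≠ 0, −1` is
`(p − 2)/(N₁N₂N₃N₄)` up to `√p`: expand the product of the four geometric sums into `N₁N₂N₃N₄` monomials
`± θ(k)^e θ(k+1)^f`, one of them trivial, the others Jacobi sums (Lemma 7 with `N = 2`).
[cite: FiteShparlinski2016, §3 (proof of Thm. 1) and Lemma 7] -/
theorem abs_card_filter_four_sub_le {N₁ N₂ N₃ N₄ c₁ c₂ c₃ c₄ : ℕ} (hN₁ : 0 < N₁) (hN₂ : Even N₂)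
    (hN₂' : 0 < N₂) (hN₃ : 0 < N₃) (hN₄ : 0 < N₄)
    (hd1 : n ∣ c₁ * N₁) (hd2 : n ∣ c₂ * N₂) (hd3 : n ∣ c₃ * N₃) (hd4 : n ∣ c₄ * N₄)
    (huniq : ∀ a < N₁, ∀ b < N₂, ∀ i < N₃, ∀ j < N₄,
      n ∣ c₁ * a + c₂ * b + c₃ * i + c₄ * j → n ∣ c₂ * b + c₄ * j → a = 0 ∧ b = 0 ∧ i = 0 ∧ j = 0) : |(((univ.filter
        (fun k : ZMod p => k ≠ 0 ∧ k + 1 ≠ 0)).filter (fun k =>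
        θ k ^ c₁ = 1 ∧ (θ k * θ (k + 1)) ^ c₂ = -1 ∧ θ k ^ c₃ = 1 ∧ (θ k * θ (k + 1)) ^ c₄ = 1)).card : ℝ)
      - ((p : ℝ) - 2) / ((N₁ : ℝ) * N₂ * N₃ * N₄)| ≤ Real.sqrt p := by
  classical
  set F' := univ.filter (fun k : ZMod p => k ≠ 0 ∧ k + 1 ≠ 0) with hF'
  set T : ℕ → ℕ → ℂ := fun i j => ∑ k ∈ F', θ k ^ i * θ (k + 1) ^ j with hT
  set V := ((F'.filter (fun k =>
        θ k ^ c₁ = 1 ∧ (θ k * θ (k + 1)) ^ c₂ = -1 ∧ θ k ^ c₃ = 1 ∧ (θ k * θ (k + 1)) ^ c₄ = 1)).card) with hV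
  set M : ℝ := (N₁ : ℝ) * N₂ * N₃ * N₄ with hM
  have hMpos : 0 < M := by rw [hM]; positivity
  -- index set (`x = (((a, b), i), j)`), coefficients, exponents
  set I : Finset (((ℕ × ℕ) × ℕ) × ℕ) := ((range N₁ ×ˢ range N₂) ×ˢ range N₃) ×ˢ range N₄ with hI
  set cf : ((ℕ × ℕ) × ℕ) × ℕ → ℂ := fun x => (-1) ^ x.1.1.2 with hcf
  set e1 : ((ℕ × ℕ) × ℕ) × ℕ → ℕ := fun x => c₁ * x.1.1.1 + c₂ * x.1.1.2 + c₃ * x.1.2 + c₄ * x.2 with he1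
  set e2 : ((ℕ × ℕ) × ℕ) × ℕ → ℕ := fun x => c₂ * x.1.1.2 + c₄ * x.2 with he2
  -- pointwise expansion
  have hW : ∀ u w : ℂ,
      (∑ a ∈ range N₁, u ^ (c₁ * a)) * (∑ b ∈ range N₂, (-1) ^ b * (u * w) ^ (c₂ * b)) *
          (∑ i ∈ range N₃, u ^ (c₃ * i)) * (∑ j ∈ range N₄, (u * w) ^ (c₄ * j)) =
        ∑ x ∈ I, cf x * (u ^ e1 x * w ^ e2 x) := by
    intro u w
    rw [Finset.sum_mul_sum, ← Finset.sum_product', Finset.sum_mul_sum, ← Finset.sum_product',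
      Finset.sum_mul_sum, ← Finset.sum_product']
    refine Finset.sum_congr rfl fun x _ => ?_
    simp only [hcf, he1, he2]
    ring
  have hid := prod_mul_card_four hg hζ hθ hN₂ hd1 hd2 hd3 hd4
  rw [← hF', ← hV] at hid
  have hexp : ∑ k ∈ F', (∑ a ∈ range N₁, θ k ^ (c₁ * a)) *
      (∑ b ∈ range N₂, (-1) ^ b * (θ k * θ (k + 1)) ^ (c₂ * b)) *
      (∑ i ∈ range N₃, θ k ^ (c₃ * i)) * (∑ j ∈ range N₄, (θ k * θ (k + 1)) ^ (c₄ * j)) =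
      ∑ x ∈ I, cf x * T (e1 x) (e2 x) := by
    rw [Finset.sum_congr rfl (fun k _ => hW (θ k) (θ (k + 1))), Finset.sum_comm]
    refine Finset.sum_congr rfl fun x _ => ?_
    rw [hT, Finset.mul_sum]
  rw [hexp] at hid
  -- isolate the trivial monomial
  have h0mem : ((((0, 0), 0), 0) : ((ℕ × ℕ) × ℕ) × ℕ) ∈ I := by
    simp [hI, hN₁, hN₂', hN₃, hN₄]
  rw [← Finset.add_sum_erase _ _ h0mem] at hid
  have h00 : cf (((0, 0), 0), 0) * T (e1 (((0, 0), 0), 0)) (e2 (((0, 0), 0), 0)) = (p : ℂ) - 2 := by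
    simp only [hcf, he1, he2, hT, pow_zero, mul_zero, add_zero, mul_one, one_mul, Finset.sum_const,
      nsmul_eq_mul]
    rw [hF', card_filter_ne_zero_ne_neg_one', Nat.cast_sub hp.out.two_le]
    norm_num
  rw [h00] at hid
  set S := ∑ x ∈ I.erase (((0, 0), 0), 0), cf x * T (e1 x) (e2 x) with hS
  -- every other monomial is Weil-bounded
  have hbound : ∀ x ∈ I.erase ((((0, 0), 0), 0) : ((ℕ × ℕ) × ℕ) × ℕ),
      ‖cf x * T (e1 x) (e2 x)‖ ≤ Real.sqrt p := by
    intro x hx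
    rw [norm_mul]
    have hc1 : ‖cf x‖ = 1 := by
      simp only [hcf, norm_pow, norm_neg, norm_one, one_pow]
    rw [hc1, one_mul]
    simp only [hT]
    rw [hF', sum_filter_pow_mul_pow_eq']
    refine norm_sum_mul_apply_add_one_le ?_
    simp only [hI, mem_erase, mem_product, mem_range, ne_eq] at hx
    obtain ⟨hne, ⟨⟨ha, hb⟩, hi⟩, hj⟩ := hx
    by_contra hdiv
    rw [not_or, not_not, not_not] at hdiv
    have hd : n ∣ e1 x ∧ n ∣ e2 x := by
      constructor
      · by_contra h; exact absurd hdiv.1 (char_pow_ne_one hζ hθ h)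
      · by_contra h; exact absurd hdiv.2 (char_pow_ne_one hζ hθ h)
    obtain ⟨h1, h2, h3, h4⟩ := huniq _ ha _ hb _ hi _ hj hd.1 hd.2
    exact hne (Prod.ext (Prod.ext (Prod.ext h1 h2) h3) h4)
  have hcardI : ((I.erase (((0, 0), 0), 0)).card : ℝ) = M - 1 := by
    rw [Finset.card_erase_of_mem h0mem, hI, Finset.card_product, Finset.card_product, Finset.card_product,
      Finset.card_range, Finset.card_range, Finset.card_range, Finset.card_range, hM]
    have : 1 ≤ N₁ * N₂ * N₃ * N₄ := Nat.one_le_iff_ne_zero.2 (by positivity)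
    push_cast [Nat.cast_sub this]
    ring
  have hS_le : ‖S‖ ≤ (M - 1) * Real.sqrt p := by
    calc ‖S‖ ≤ ∑ x ∈ I.erase (((0, 0), 0), 0), ‖cf x * T (e1 x) (e2 x)‖ := norm_sum_le _ _
      _ ≤ ∑ x ∈ I.erase (((0, 0), 0), 0), Real.sqrt p := Finset.sum_le_sum hbound
      _ = (M - 1) * Real.sqrt p := by rw [Finset.sum_const, nsmul_eq_mul, hcardI]
  -- real parts
  have hre := congr_arg Complex.re hid
  simp only [Complex.mul_re, Complex.add_re, Complex.sub_re, Complex.natCast_re, Complex.natCast_im,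
    Complex.re_ofNat, mul_zero, sub_zero] at hre
  have hSre : |S.re| ≤ (M - 1) * Real.sqrt p := (Complex.abs_re_le_norm S).trans hS_le
  -- `M · V = (p − 2) + Re S`
  have hMV : M * (V : ℝ) = ((p : ℝ) - 2) + S.re := by
    rw [hM]
    linarith [hre]
  have hdiff : (V : ℝ) - ((p : ℝ) - 2) / M = S.re / M := by
    field_simp
    linarith [hMV]
  rw [hdiff, abs_div, abs_of_pos hMpos, div_le_iff₀ hMpos]
  have hsq : 0 ≤ Real.sqrt (p : ℝ) := Real.sqrt_nonneg _
  nlinarith [hSre, hsq, hMpos]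

end FourConditions

/-! ## §9 The exact count of (ii) ∧ (iii) through one character of order `2^α 3^β`: Theorem 1 -/

section ExactCount

variable {p : ℕ} [hp : Fact p.Prime]

/-- For `d ∣ N` with `3^β ‖ N` and `j ≤ β`: `d ∣ N / 3^{β−j} ↔ ν₃(d) ≤ j`. [folklore] -/
private theorem dvd_div_pow_iff_padicValNat_le {d N β j : ℕ} (hN : N ≠ 0) (hd : d ∣ N) (hβ : 3 ^ β ∣ N)
    (hβ' : ¬ 3 ^ (β + 1) ∣ N) (hj : j ≤ β) : d ∣ N / 3 ^ (β - j) ↔ padicValNat 3 d ≤ j := by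
  obtain ⟨N', hN'⟩ := hβ
  have h3N' : ¬ 3 ∣ N' := by
    intro h
    apply hβ'
    rw [hN', pow_succ]
    exact mul_dvd_mul_left _ h
  have hdiv : N / 3 ^ (β - j) = 3 ^ j * N' := by
    rw [hN', show 3 ^ β = 3 ^ (β - j) * 3 ^ j by rw [← pow_add, Nat.sub_add_cancel hj], mul_assoc,
      Nat.mul_div_cancel_left _ (by positivity)]
  rw [hdiv]
  have hd0 : d ≠ 0 := by
    rintro rfl
    exact hN (zero_dvd_iff.1 hd)
  obtain ⟨v, d', hd'3, hdd⟩ := Nat.exists_eq_pow_mul_and_not_dvd hd0 3 (by norm_num)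
  have hd'0 : d' ≠ 0 := by
    rintro rfl
    exact hd'3 (dvd_zero 3)
  have hv : padicValNat 3 d = v := by
    rw [hdd, padicValNat.mul (by positivity) hd'0, padicValNat.prime_pow,
      padicValNat.eq_zero_of_not_dvd hd'3, add_zero]
  have h3 : Nat.Coprime 3 N' := (Nat.Prime.coprime_iff_not_dvd Nat.prime_three).2 h3N'
  have h3' : Nat.Coprime 3 d' := (Nat.Prime.coprime_iff_not_dvd Nat.prime_three).2 hd'3
  rw [hv]
  constructor
  · intro h
    have h1 : 3 ^ v ∣ 3 ^ j * N' := dvd_trans (Dvd.intro _ hdd.symm) h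
    have h2 : 3 ^ v ∣ 3 ^ j := (h3.pow_left v).dvd_of_dvd_mul_right h1
    exact (Nat.pow_dvd_pow_iff_le_right (by norm_num)).1 h2
  · intro h
    have hd'N : d' ∣ N' := by
      have : d' ∣ 3 ^ β * N' := by
        rw [← hN']
        exact dvd_trans (Dvd.intro_left _ hdd.symm) hd
      exact (h3'.symm.pow_right β).dvd_of_dvd_mul_left this
    rw [hdd]
    exact mul_dvd_mul (pow_dvd_pow 3 h) hd'N

/-- `x^{(p−1)/2^α} = 1 ↔ ord x` is odd (`x ≠ 0`, `2^α ‖ p − 1`). [folklore] -/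
private theorem pow_div_eq_one_iff_odd_orderOf {α : ℕ} (hα : 2 ^ α ∣ p - 1) (hodd : Odd ((p - 1) / 2 ^ α))
    {x : ZMod p} (hx : x ≠ 0) : x ^ ((p - 1) / 2 ^ α) = 1 ↔ Odd (orderOf x) := by
  constructor
  · intro h
    exact hodd.of_dvd_nat (orderOf_dvd_of_pow_eq_one h)
  · intro h
    apply orderOf_dvd_iff_pow_eq_one.1
    have hdvd : orderOf x ∣ p - 1 := ZMod.orderOf_dvd_card_sub_one hx
    obtain ⟨t, ht⟩ := hα
    rw [ht, Nat.mul_div_cancel_left _ (by positivity)]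
    rw [ht, mul_comm] at hdvd
    exact (h.coprime_two_right.pow_right α).dvd_of_dvd_mul_right hdvd

/-- For `h = −k² − k = −k(k+1)`: `ord h` is odd iff `(k(k+1))^{(p−1)/2^α} = −1` (`2^α ‖ p − 1`). [folklore] -/
private theorem odd_orderOf_neg_iff {α : ℕ} (hα : 2 ^ α ∣ p - 1) (hodd : Odd ((p - 1) / 2 ^ α))
    {k : ZMod p} (hk : k ≠ 0) (hk1 : k + 1 ≠ 0) :
    Odd (orderOf (-k ^ 2 - k)) ↔ (k * (k + 1)) ^ ((p - 1) / 2 ^ α) = -1 := by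
  have hh : -k ^ 2 - k = -(k * (k + 1)) := by ring
  have hh0 : -k ^ 2 - k ≠ 0 := by
    rw [hh]
    exact neg_ne_zero.2 (mul_ne_zero hk hk1)
  rw [← pow_div_eq_one_iff_odd_orderOf hα hodd hh0, hh, neg_pow, hodd.neg_one_pow]
  constructor
  · intro h; linear_combination -h
  · intro h; rw [h]; ring

omit hp in
/-- `(p − 1)/3^{β−e}` is even once `2 ∣ p − 1` and `3^β ∣ p − 1`. [folklore] -/
private theorem even_div_pow_three {β e : ℕ} (h2 : 2 ∣ p - 1) (hβ : 3 ^ β ∣ p - 1) :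
    Even ((p - 1) / 3 ^ (β - e)) := by
  have hdvd : 3 ^ (β - e) ∣ p - 1 := dvd_trans (pow_dvd_pow 3 (Nat.sub_le β e)) hβ
  obtain ⟨E, hE⟩ := hdvd
  rw [hE, Nat.mul_div_cancel_left _ (by positivity)]
  have hodd3 : Odd (3 ^ (β - e)) := Odd.pow (by decide)
  rw [hE] at h2
  rcases (Nat.even_mul.1 (even_iff_two_dvd.2 h2)) with h | h
  · exact absurd h (Nat.not_even_iff_odd.2 hodd3)
  · exact h

variable {g : (ZMod p)ˣ} {ζ : ℂ} {θ : MulChar (ZMod p) ℂ} {q β : ℕ}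
variable (hg : ∀ x : (ZMod p)ˣ, x ∈ Subgroup.zpowers g) (hζ : IsPrimitiveRoot ζ (q * 3 ^ β)) (hθ : θ g = ζ)
include hg hζ hθ

/-- **Dictionary for a character of order `q·3^β` (`q = 2^α ‖ p − 1`, `3^β ‖ p − 1`)**: for `x ≠ 0`,
`θ(x)^{3^β} = −1 ↔ x^{(p−1)/q} = −1`. [folklore] -/
private theorem theta_pow_eq_neg_one_iff (hp2 : p ≠ 2) (hq : Even q) (hq0 : 0 < q) (hn : q * 3 ^ β ∣ p - 1)
    {x : ZMod p} (hx : x ≠ 0) : θ x ^ 3 ^ β = -1 ↔ x ^ ((p - 1) / q) = -1 := by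
  obtain ⟨r, hr⟩ := hq
  have hr0 : 0 < r := by omega
  have hqr : q = 2 * r := by omega
  have hne : (-1 : ZMod p) ≠ 1 := by
    intro h
    have h2 : (2 : ZMod p) = 0 := by linear_combination -h
    have : ((2 : ℕ) : ZMod p) = 0 := by exact_mod_cast h2
    rw [ZMod.natCast_eq_zero_iff] at this
    exact hp2 ((Nat.prime_dvd_prime_iff_eq hp.out Nat.prime_two).1 this)
  have hneC : (-1 : ℂ) ≠ 1 := by norm_num
  -- `θ(x)^{3^β} = 1 ↔ x^{(p−1)/q} = 1` and `θ(x)^{2·3^β} = 1 ↔ x^{(p−1)/r} = 1`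
  have e1 := apply_pow_div_eq_one_iff hg hζ hθ hn (d := q) (Dvd.intro _ rfl) hq0 hx
  rw [Nat.mul_div_cancel_left _ hq0] at e1
  have e2 := apply_pow_div_eq_one_iff hg hζ hθ hn (d := r) ⟨2 * 3 ^ β, by rw [hqr]; ring⟩ hr0 hx
  have h6 : q * 3 ^ β / r = 2 * 3 ^ β := by
    rw [hqr, mul_comm 2 r, mul_assoc, Nat.mul_div_cancel_left _ hr0]
  rw [h6] at e2
  have hdiv : (p - 1) / r = (p - 1) / q * 2 := by
    obtain ⟨t, ht⟩ := hn
    rw [ht, hqr, show 2 * r * 3 ^ β * t = r * (2 * (3 ^ β * t)) by ring, Nat.mul_div_cancel_left _ hr0,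
      show r * (2 * (3 ^ β * t)) = (2 * r) * (3 ^ β * t) by ring, Nat.mul_div_cancel_left _ (by omega)]
    ring
  constructor
  · intro h
    have hsq : (x ^ ((p - 1) / q)) ^ 2 = 1 := by
      rw [← pow_mul, ← hdiv]
      exact e2.1 (by rw [pow_mul', h]; norm_num)
    have hne1 : x ^ ((p - 1) / q) ≠ 1 := fun h1 => by
      have := e1.2 h1
      rw [this] at h
      exact hneC h.symm
    exact eq_neg_one_of_sq hsq hne1
  · intro h
    have hsq : (θ x ^ 3 ^ β) ^ 2 = 1 := by
      rw [← pow_mul, mul_comm (3 ^ β) 2]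
      exact e2.2 (by rw [hdiv, pow_mul, h]; norm_num)
    have hne1 : θ x ^ 3 ^ β ≠ 1 := fun h1 => by
      have := e1.1 h1
      rw [this] at h
      exact hne h.symm
    exact eq_neg_one_of_sq hsq hne1

/-- **Dictionary**: `θ(x)^{q·3^j} = 1 ↔ ν₃(ord x) ≤ j` for `x ≠ 0`, `j ≤ β`, `3^β ‖ p − 1`. [folklore] -/
private theorem theta_pow_eq_one_iff_padicValNat_le (hn : q * 3 ^ β ∣ p - 1) (hβ : 3 ^ β ∣ p - 1)
    (hβ' : ¬ 3 ^ (β + 1) ∣ p - 1) {j : ℕ} (hj : j ≤ β) {x : ZMod p} (hx : x ≠ 0) :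
    θ x ^ (q * 3 ^ j) = 1 ↔ padicValNat 3 (orderOf x) ≤ j := by
  have hp1 : p - 1 ≠ 0 := by have := hp.out.two_le; omega
  have e := apply_pow_div_eq_one_iff hg hζ hθ hn (d := 3 ^ (β - j))
    ⟨q * 3 ^ j, by rw [mul_comm q (3 ^ j), ← mul_assoc, ← pow_add, Nat.sub_add_cancel hj, mul_comm]⟩
    (by positivity) hx
  have hdiv : q * 3 ^ β / 3 ^ (β - j) = q * 3 ^ j := by
    rw [show 3 ^ β = 3 ^ (β - j) * 3 ^ j by rw [← pow_add, Nat.sub_add_cancel hj], mul_comm q, mul_assoc,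
      Nat.mul_div_cancel_left _ (by positivity), mul_comm]
  rw [hdiv] at e
  rw [e, ← orderOf_dvd_iff_pow_eq_one]
  exact dvd_div_pow_iff_padicValNat_le hp1 (ZMod.orderOf_dvd_card_sub_one hx) hβ hβ' hj

omit hg hζ hθ in
/-- The arithmetic behind «exactly one trivial monomial»: for `q` prime to `3`, `e ≤ β`, `b < q`, `i < 3^{β−e}`,
`q·3^β ∣ 3^β b + q 3^e i` forces `b = i = 0`. [folklore] -/
private theorem eq_zero_of_dvd_mixed {e b i : ℕ} (hq3 : Nat.Coprime q (3 ^ β)) (hq0 : 0 < q) (he : e ≤ β)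
    (hb : b < q) (hi : i < 3 ^ (β - e)) (h : q * 3 ^ β ∣ 3 ^ β * b + q * 3 ^ e * i) : b = 0 ∧ i = 0 := by
  have hqb : q ∣ 3 ^ β * b := by
    have : q ∣ 3 ^ β * b + q * 3 ^ e * i := dvd_trans (Dvd.intro _ rfl) h
    exact (Nat.dvd_add_left ⟨3 ^ e * i, by ring⟩).1 this
  have hb0 : b = 0 := Nat.eq_zero_of_dvd_of_lt (hq3.dvd_of_dvd_mul_left hqb) hb
  subst hb0
  rw [mul_zero, zero_add, mul_assoc] at h
  have h1 : 3 ^ β ∣ 3 ^ e * i := Nat.dvd_of_mul_dvd_mul_left hq0 h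
  rw [show 3 ^ β = 3 ^ e * 3 ^ (β - e) by rw [← pow_add, Nat.add_sub_cancel' he]] at h1
  have h2 : 3 ^ (β - e) ∣ i := Nat.dvd_of_mul_dvd_mul_left (by positivity) h1
  exact ⟨rfl, Nat.eq_zero_of_dvd_of_lt h2 hi⟩

omit hg hζ hθ in
/-- **The box count for the sets `V(j, e) = {k ≠ 0,−1 : ord(−k²−k), ord k odd, ν₃(ord k) ≤ j, ν₃(ord(−k²−k)) ≤ e}`**
(`2^α ‖ p − 1`, `3^β ‖ p − 1`, `β ≥ 1`, `j, e ≤ β`): `|#V(j,e) − (p − 2)/(4^α 3^{β−j} 3^{β−e})| ≤ √p` — the four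
conditions are `θ(k)^{3^β} = 1`, `θ(k(k+1))^{3^β} = −1`, `θ(k)^{q3^j} = 1`, `θ(k(k+1))^{q3^e} = 1` for ONE character
`θ` of order `q·3^β` (`q = 2^α`), and the box `[0,q)²×[0,3^{β−j})×[0,3^{β−e})` has exactly one trivial monomial.
[cite: FiteShparlinski2016, §3 (proof of Thm. 1): (2.1)–(2.3)] -/
theorem abs_card_filter_valuation_sub_le {α : ℕ} (hα : 2 ^ α ∣ p - 1) (hodd : Odd ((p - 1) / 2 ^ α))
    (hβ : 3 ^ β ∣ p - 1) (hβ' : ¬ 3 ^ (β + 1) ∣ p - 1) (hβ1 : 1 ≤ β) {j e : ℕ} (hj : j ≤ β) (he : e ≤ β) :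
    |(((univ.filter (fun k : ZMod p => k ≠ 0 ∧ k + 1 ≠ 0)).filter (fun k =>
        Odd (orderOf (-k ^ 2 - k)) ∧ Odd (orderOf k) ∧ padicValNat 3 (orderOf k) ≤ j ∧
        padicValNat 3 (orderOf (-k ^ 2 - k)) ≤ e)).card : ℝ)
      - ((p : ℝ) - 2) / ((4 : ℝ) ^ α * 3 ^ (β - j) * 3 ^ (β - e))| ≤ Real.sqrt p := by
  classical
  have h3 : 3 ∣ p - 1 := dvd_trans (dvd_pow_self 3 (by omega)) hβ
  have hp2 : p ≠ 2 := by rintro rfl; norm_num at h3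
  have h2 : 2 ∣ p - 1 := by
    obtain ⟨r, hr⟩ := hp.out.odd_of_ne_two hp2
    exact ⟨r, by omega⟩
  have hα1 : 1 ≤ α := by
    by_contra h
    have hα0 : α = 0 := by omega
    rw [hα0, pow_zero, Nat.div_one] at hodd
    obtain ⟨r, hr⟩ := hp.out.odd_of_ne_two hp2
    obtain ⟨s, hs⟩ := hodd
    omega
  obtain ⟨q, hqdef⟩ : ∃ q : ℕ, q = 2 ^ α := ⟨_, rfl⟩
  rw [← hqdef] at hα hodd
  have hq0 : 0 < q := by rw [hqdef]; positivity
  have hqeven : Even q := by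
    rw [hqdef, show α = (α - 1) + 1 by omega, pow_succ]
    exact even_two.mul_left _
  have hq3 : Nat.Coprime q (3 ^ β) := by
    rw [hqdef]
    exact Nat.Coprime.pow _ _ (by norm_num)
  have hn : q * 3 ^ β ∣ p - 1 := hq3.mul_dvd_of_dvd_of_dvd hα hβ
  -- a generator and the character `g ↦ ζ_{q 3^β}`
  obtain ⟨g, hg⟩ := IsCyclic.exists_generator (α := (ZMod p)ˣ)
  have hn0 : q * 3 ^ β ≠ 0 := by positivity
  have hζ : IsPrimitiveRoot (Complex.exp (2 * Real.pi * Complex.I / ((q * 3 ^ β : ℕ) : ℂ))) (q * 3 ^ β) :=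
    Complex.isPrimitiveRoot_exp _ hn0
  set ζ : ℂ := Complex.exp (2 * Real.pi * Complex.I / ((q * 3 ^ β : ℕ) : ℂ)) with hζdef
  have hζunit : IsUnit ζ := hζ.isUnit hn0
  have hζmem : hζunit.unit ∈ rootsOfUnity (Fintype.card (ZMod p)ˣ) ℂ := by
    rw [mem_rootsOfUnity, ZMod.card_units, Units.ext_iff, Units.val_pow_eq_pow_val, IsUnit.unit_spec,
      Units.val_one]
    exact (hζ.pow_eq_one_iff_dvd _).2 hn
  set θ : MulChar (ZMod p) ℂ := MulChar.ofRootOfUnity hζmem hg with hθdef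
  have hθ : θ g = ζ := by
    have h := MulChar.ofRootOfUnity_spec hζmem hg
    rw [← hθdef] at h
    rw [h, IsUnit.unit_spec]
  -- the generic box count
  have hgen := abs_card_filter_four_sub_le hg hζ hθ (N₁ := q) (N₂ := q) (N₃ := 3 ^ (β - j))
    (N₄ := 3 ^ (β - e)) (c₁ := 3 ^ β) (c₂ := 3 ^ β) (c₃ := q * 3 ^ j) (c₄ := q * 3 ^ e)
    hq0 hqeven hq0 (by positivity) (by positivity) (by rw [mul_comm])  (by rw [mul_comm])
    (by rw [mul_assoc, ← pow_add, Nat.add_sub_cancel' hj]) (by rw [mul_assoc, ← pow_add, Nat.add_sub_cancel' he])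
    (by
      intro a ha b hb i hi i' hi' h1 h2
      obtain ⟨hb0, hi'0⟩ := eq_zero_of_dvd_mixed hq3 hq0 he hb hi' h2
      subst hb0; subst hi'0
      have h1' : q * 3 ^ β ∣ 3 ^ β * a + q * 3 ^ j * i := by
        have : 3 ^ β * a + 3 ^ β * 0 + q * 3 ^ j * i + q * 3 ^ e * 0 = 3 ^ β * a + q * 3 ^ j * i := by ring
        rwa [this] at h1
      obtain ⟨ha0, hi0⟩ := eq_zero_of_dvd_mixed hq3 hq0 hj ha hi h1'
      exact ⟨ha0, rfl, hi0, rfl⟩)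
  -- the dictionary
  have hcongr : (univ.filter (fun k : ZMod p => k ≠ 0 ∧ k + 1 ≠ 0)).filter (fun k =>
        θ k ^ 3 ^ β = 1 ∧ (θ k * θ (k + 1)) ^ 3 ^ β = -1 ∧ θ k ^ (q * 3 ^ j) = 1 ∧
        (θ k * θ (k + 1)) ^ (q * 3 ^ e) = 1) =
      (univ.filter (fun k : ZMod p => k ≠ 0 ∧ k + 1 ≠ 0)).filter (fun k =>
        Odd (orderOf (-k ^ 2 - k)) ∧ Odd (orderOf k) ∧ padicValNat 3 (orderOf k) ≤ j ∧
        padicValNat 3 (orderOf (-k ^ 2 - k)) ≤ e) := by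
    refine Finset.filter_congr fun k hk => ?_
    simp only [mem_filter, mem_univ, true_and] at hk
    obtain ⟨hk0, hk1⟩ := hk
    have hkk : k * (k + 1) ≠ 0 := mul_ne_zero hk0 hk1
    have hh : -k ^ 2 - k = -(k * (k + 1)) := by ring
    have hh0 : -k ^ 2 - k ≠ 0 := by rw [hh]; exact neg_ne_zero.2 hkk
    -- (1) `θ(k)^{3^β} = 1 ↔ ord k odd`
    have d1 : θ k ^ 3 ^ β = 1 ↔ Odd (orderOf k) := by
      have e1 := apply_pow_div_eq_one_iff hg hζ hθ hn (d := q) (Dvd.intro _ rfl) hq0 hk0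
      rw [Nat.mul_div_cancel_left _ hq0] at e1
      rw [e1, hqdef]
      exact pow_div_eq_one_iff_odd_orderOf (hqdef ▸ hα) (hqdef ▸ hodd) hk0
    -- (2) `θ(k(k+1))^{3^β} = −1 ↔ ord(−k²−k) odd`
    have d2 : (θ k * θ (k + 1)) ^ 3 ^ β = -1 ↔ Odd (orderOf (-k ^ 2 - k)) := by
      rw [← map_mul, theta_pow_eq_neg_one_iff hg hζ hθ hp2 hqeven hq0 hn hkk, hqdef,
        odd_orderOf_neg_iff (hqdef ▸ hα) (hqdef ▸ hodd) hk0 hk1]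
    -- (3) `θ(k)^{q3^j} = 1 ↔ ν₃(ord k) ≤ j`
    have d3 : θ k ^ (q * 3 ^ j) = 1 ↔ padicValNat 3 (orderOf k) ≤ j :=
      theta_pow_eq_one_iff_padicValNat_le hg hζ hθ hn hβ hβ' hj hk0
    -- (4) `θ(k(k+1))^{q3^e} = 1 ↔ ν₃(ord(−k²−k)) ≤ e` (the exponent `(p−1)/3^{β−e}` is even)
    have d4 : (θ k * θ (k + 1)) ^ (q * 3 ^ e) = 1 ↔ padicValNat 3 (orderOf (-k ^ 2 - k)) ≤ e := by
      rw [← map_mul, theta_pow_eq_one_iff_padicValNat_le hg hζ hθ hn hβ hβ' he hkk]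
      have hp1 : p - 1 ≠ 0 := by have := hp.out.two_le; omega
      rw [← dvd_div_pow_iff_padicValNat_le hp1 (ZMod.orderOf_dvd_card_sub_one hkk) hβ hβ' he,
        ← dvd_div_pow_iff_padicValNat_le hp1 (ZMod.orderOf_dvd_card_sub_one hh0) hβ hβ' he,
        orderOf_dvd_iff_pow_eq_one, orderOf_dvd_iff_pow_eq_one, hh, neg_pow,
        (even_div_pow_three h2 hβ).neg_one_pow, one_mul]
    rw [d1, d2, d3, d4]
    constructor
    · rintro ⟨a, b, c, d⟩; exact ⟨b, a, c, d⟩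
    · rintro ⟨a, b, c, d⟩; exact ⟨b, a, c, d⟩
  rw [hcongr] at hgen
  have hden : ((q : ℝ) * q * ((3 ^ (β - j) : ℕ) : ℝ) * ((3 ^ (β - e) : ℕ) : ℝ)) =
      (4 : ℝ) ^ α * 3 ^ (β - j) * 3 ^ (β - e) := by
    rw [hqdef]
    push_cast
    rw [← mul_pow]
    norm_num
  rw [hden] at hgen
  exact hgen

omit hg hζ hθ

/-- **Fité–Shparlinski's Theorem 1, two-sided and with a sharper constant.** For a prime `p` with `2^α ‖ p − 1` and
`3^β ‖ p − 1`, the number `#K*_p` of `k ≠ 0, −1` satisfying (ii) and (iii) of Lemma 6 (`ord k`, `ord(−k²−k)` odd,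
`ν₃(ord(−k²−k)) < ν₃(ord k)`) satisfies `|#K*_p − (p − 2)(1 − 3^{−2β})/2^{2α+2}| ≤ 2β√p`.  Proof: `K*` is the
disjoint union over `r = ν₃(ord k) ∈ [1, β]` of `V(r, r−1) ∖ V(r−1, r−1)` (notation of
`abs_card_filter_valuation_sub_le`), each `V` is counted up to `√p`, and
`Σ_{r=1}^{β} (3 − 1)/(4^α 9^{β−r+1}) = (1 − 9^{−β})/(4·4^α)` ([FS]: «`a₀ = (1 − 3^{−2β})/2^{2α+2}`»).
[cite: FiteShparlinski2016, Thm. 1 and §3 (proof)] -/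
theorem abs_card_lemma6_sub_main_le {α β : ℕ} (hα : 2 ^ α ∣ p - 1) (hodd : Odd ((p - 1) / 2 ^ α))
    (hβ : 3 ^ β ∣ p - 1) (hβ' : ¬ 3 ^ (β + 1) ∣ p - 1) :
    |(((univ.filter (fun k : ZMod p => k ≠ 0 ∧ k + 1 ≠ 0)).filter (fun k =>
        Odd (orderOf (-k ^ 2 - k)) ∧ Odd (orderOf k) ∧
        padicValNat 3 (orderOf (-k ^ 2 - k)) < padicValNat 3 (orderOf k))).card : ℝ)
      - ((p : ℝ) - 2) * (1 - (1 / 9) ^ β) / (4 * 4 ^ α)| ≤ 2 * β * Real.sqrt p := by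
  classical
  set K := (univ.filter (fun k : ZMod p => k ≠ 0 ∧ k + 1 ≠ 0)).filter (fun k =>
        Odd (orderOf (-k ^ 2 - k)) ∧ Odd (orderOf k) ∧
        padicValNat 3 (orderOf (-k ^ 2 - k)) < padicValNat 3 (orderOf k)) with hK
  set V : ℕ → ℕ → Finset (ZMod p) := fun j e => (univ.filter (fun k : ZMod p => k ≠ 0 ∧ k + 1 ≠ 0)).filter
      (fun k => Odd (orderOf (-k ^ 2 - k)) ∧ Odd (orderOf k) ∧ padicValNat 3 (orderOf k) ≤ j ∧
        padicValNat 3 (orderOf (-k ^ 2 - k)) ≤ e) with hV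
  set mt : ℕ → ℕ → ℝ := fun j e => ((p : ℝ) - 2) / ((4 : ℝ) ^ α * 3 ^ (β - j) * 3 ^ (β - e)) with hmt
  -- the fibres of `ν₃(ord k)` over `K`
  have hfib : K.card = ∑ i ∈ range β, (K.filter (fun k => padicValNat 3 (orderOf k) - 1 = i)).card := by
    refine Finset.card_eq_sum_card_fiberwise fun k hk => ?_
    have hk' : k ∈ K := hk
    simp only [hK, mem_filter, mem_univ, true_and] at hk'
    obtain ⟨⟨hk0, -⟩, -, -, hlt⟩ := hk'
    have hle : padicValNat 3 (orderOf k) ≤ β := by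
      by_contra h
      apply hβ'
      exact dvd_trans (pow_dvd_pow 3 (by omega))
        (dvd_trans pow_padicValNat_dvd (ZMod.orderOf_dvd_card_sub_one hk0))
    simp only [coe_range, Set.mem_Iio]
    omega
  have hfibre : ∀ i ∈ range β,
      K.filter (fun k => padicValNat 3 (orderOf k) - 1 = i) = V (i + 1) i \ V i i := by
    intro i _
    ext k
    simp only [hK, hV, mem_filter, mem_sdiff, mem_univ, true_and]
    constructor
    · rintro ⟨⟨hF, ho1, ho2, hlt⟩, hi'⟩
      refine ⟨⟨hF, ho1, ho2, by omega, by omega⟩, ?_⟩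
      rintro ⟨-, -, -, hle, -⟩
      omega
    · rintro ⟨⟨hF, ho1, ho2, hle1, hle2⟩, hnot⟩
      have : ¬ padicValNat 3 (orderOf k) ≤ i := fun h => hnot ⟨hF, ho1, ho2, h, hle2⟩
      exact ⟨⟨hF, ho1, ho2, by omega⟩, by omega⟩
  have hsub : ∀ i, V i i ⊆ V (i + 1) i := by
    intro i k hk
    simp only [hV, mem_filter] at hk ⊢
    exact ⟨hk.1, hk.2.1, hk.2.2.1, by omega, hk.2.2.2.2⟩
  have hcardfib : ∀ i ∈ range β, ((K.filter (fun k => padicValNat 3 (orderOf k) - 1 = i)).card : ℝ) =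
      ((V (i + 1) i).card : ℝ) - ((V i i).card : ℝ) := by
    intro i hi
    rw [hfibre i hi, Finset.card_sdiff_of_subset (hsub i), Nat.cast_sub (Finset.card_le_card (hsub i))]
  -- per-fibre estimate
  have hest : ∀ i ∈ range β,
      |(((V (i + 1) i).card : ℝ) - ((V i i).card : ℝ)) - (mt (i + 1) i - mt i i)| ≤ 2 * Real.sqrt p := by
    intro i hi
    rw [mem_range] at hi
    have h1 := abs_card_filter_valuation_sub_le (p := p) hα hodd hβ hβ' (by omega) (j := i + 1) (e := i)
      (by omega) (by omega)
    have h2 := abs_card_filter_valuation_sub_le (p := p) hα hodd hβ hβ' (by omega) (j := i) (e := i)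
      (by omega) (by omega)
    have key : ∀ a b c d t : ℝ, |a - c| ≤ t → |b - d| ≤ t → |a - b - (c - d)| ≤ 2 * t := by
      intro a b c d t ha hb
      calc |a - b - (c - d)| = |(a - c) - (b - d)| := by ring_nf
        _ ≤ |a - c| + |b - d| := abs_sub _ _
        _ ≤ 2 * t := by linarith
    simp only [hV, hmt]
    exact key _ _ _ _ _ h1 h2
  -- the main term: a geometric sum
  have hterm : ∀ i ∈ range β, mt (i + 1) i - mt i i =
      2 * ((p : ℝ) - 2) / ((4 : ℝ) ^ α * 3 ^ (β - 1 - i + 1) * 3 ^ (β - 1 - i + 1)) := by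
    intro i hi
    rw [mem_range] at hi
    obtain ⟨d, hd⟩ : ∃ d, β - i = d + 1 := ⟨β - i - 1, by omega⟩
    have hd1 : β - (i + 1) = d := by omega
    have hd2 : β - 1 - i + 1 = d + 1 := by omega
    simp only [hmt]
    rw [hd, hd1, hd2, pow_succ]
    field_simp
    ring
  have hgeom : ∑ i ∈ range β, (mt (i + 1) i - mt i i) = ((p : ℝ) - 2) * (1 - (1 / 9) ^ β) / (4 * 4 ^ α) := by
    rw [Finset.sum_congr rfl hterm]
    have hrefl := Finset.sum_range_reflect (fun j => 2 * ((p : ℝ) - 2) / ((4 : ℝ) ^ α * 3 ^ (j + 1) * 3 ^ (j + 1))) β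
    rw [hrefl]
    have hterm' : ∀ j : ℕ, 2 * ((p : ℝ) - 2) / ((4 : ℝ) ^ α * 3 ^ (j + 1) * 3 ^ (j + 1)) =
        (2 * ((p : ℝ) - 2) / (9 * 4 ^ α)) * (1 / 9) ^ j := by
      intro j
      rw [one_div_pow, show (9 : ℝ) = 3 ^ 2 by norm_num, ← pow_mul]
      field_simp
      ring
    rw [Finset.sum_congr rfl (fun j _ => hterm' j), ← Finset.mul_sum, geom_sum_eq (by norm_num)]
    field_simp
    ring
  -- assemble
  have hKsum : (K.card : ℝ) = ∑ i ∈ range β, (((V (i + 1) i).card : ℝ) - ((V i i).card : ℝ)) := by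
    rw [hfib]
    push_cast
    exact Finset.sum_congr rfl hcardfib
  rw [hKsum, ← hgeom, ← Finset.sum_sub_distrib]
  calc |∑ i ∈ range β, ((((V (i + 1) i).card : ℝ) - ((V i i).card : ℝ)) - (mt (i + 1) i - mt i i))|
      ≤ ∑ i ∈ range β, |(((V (i + 1) i).card : ℝ) - ((V i i).card : ℝ)) - (mt (i + 1) i - mt i i)| :=
        Finset.abs_sum_le_sum_abs _ _
    _ ≤ ∑ i ∈ range β, 2 * Real.sqrt p := Finset.sum_le_sum hest
    _ = 2 * β * Real.sqrt p := by rw [Finset.sum_const, Finset.card_range, nsmul_eq_mul]; ring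

/-- **Fité–Shparlinski 2016, THEOREM 1 (as printed).** «Let `ℓ − 1 = 2^α 3^β m` for some integers `α > 0`,
`β ≥ 0` and `m` with `gcd(m, 6) = 1`. Then `|#K_ℓ − ℓ(1 − 3^{−2β})/2^{2α+2}| ≤ 4β²√ℓ + 33/16`.»  Here `#K_ℓ` is
the number of `k ≠ 0, −1 (mod ℓ)` with `ord k ≠ 3` satisfying (ii), (iii) of Lemma 6 (= `k ∈ K_ℓ`, [FGL] Thm. 4.10;
tree `isNondegenerate_fermat_iff_orderOf`: the Fermat CM type `Φ_{S_k}` is degenerate).  From the sharper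
`abs_card_lemma6_sub_main_le` (constant `2β`, main term at `ℓ − 2`) and `#K*_ℓ − 2 ≤ #K_ℓ ≤ #K*_ℓ`.
[cite: FiteShparlinski2016, Thm. 1] -/
theorem fiteShparlinski_thm_1 {α β m : ℕ} (hℓ : p - 1 = 2 ^ α * 3 ^ β * m) (hα : 0 < α)
    (hm : Nat.Coprime m 6) :
    |(((univ.filter (fun k : ZMod p => k ≠ 0 ∧ k + 1 ≠ 0)).filter (fun k => orderOf k ≠ 3 ∧
        Odd (orderOf (-k ^ 2 - k)) ∧ Odd (orderOf k) ∧
        padicValNat 3 (orderOf (-k ^ 2 - k)) < padicValNat 3 (orderOf k))).card : ℝ)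
      - (p : ℝ) * (1 - 1 / 3 ^ (2 * β)) / 2 ^ (2 * α + 2)| ≤ 4 * (β : ℝ) ^ 2 * Real.sqrt p + 33 / 16 := by
  classical
  have _hα := hα
  -- the `2`- and `3`-adic data of `p − 1`
  have hdvd : 2 ^ α ∣ p - 1 := ⟨3 ^ β * m, by rw [hℓ]; ring⟩
  have h3m : ¬ 3 ∣ m := by
    intro h
    have := Nat.dvd_gcd h (by norm_num : 3 ∣ 6)
    rw [hm] at this
    omega
  have h2m : Odd m := Nat.coprime_two_right.mp (Nat.Coprime.coprime_dvd_right (by norm_num : 2 ∣ 6) hm)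
  have hodd : Odd ((p - 1) / 2 ^ α) := by
    rw [hℓ, mul_assoc, Nat.mul_div_cancel_left _ (by positivity)]
    exact (Odd.pow (by decide : Odd 3)).mul h2m
  have hβ : 3 ^ β ∣ p - 1 := ⟨2 ^ α * m, by rw [hℓ]; ring⟩
  have hβ' : ¬ 3 ^ (β + 1) ∣ p - 1 := by
    rintro ⟨c, hc⟩
    apply h3m
    have h3c : 3 ^ β * (2 ^ α * m) = 3 ^ β * (3 * c) := by
      calc 3 ^ β * (2 ^ α * m) = 2 ^ α * 3 ^ β * m := by ring
        _ = p - 1 := hℓ.symm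
        _ = 3 ^ (β + 1) * c := hc
        _ = 3 ^ β * (3 * c) := by ring
    have := Nat.eq_of_mul_eq_mul_left (by positivity) h3c
    have h32 : Nat.Coprime 3 (2 ^ α) := Nat.Coprime.pow_right _ (by norm_num)
    exact h32.dvd_of_dvd_mul_left ⟨c, this⟩
  -- `K ⊆ K*`, `#K* − #K ≤ 2`
  set K' := (univ.filter (fun k : ZMod p => k ≠ 0 ∧ k + 1 ≠ 0)).filter (fun k =>
        Odd (orderOf (-k ^ 2 - k)) ∧ Odd (orderOf k) ∧
        padicValNat 3 (orderOf (-k ^ 2 - k)) < padicValNat 3 (orderOf k)) with hK'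
  have hKeq : (univ.filter (fun k : ZMod p => k ≠ 0 ∧ k + 1 ≠ 0)).filter (fun k => orderOf k ≠ 3 ∧
        Odd (orderOf (-k ^ 2 - k)) ∧ Odd (orderOf k) ∧
        padicValNat 3 (orderOf (-k ^ 2 - k)) < padicValNat 3 (orderOf k)) =
      K'.filter (fun k => orderOf k ≠ 3) := by
    ext k
    simp only [hK', mem_filter, mem_univ, true_and]
    tauto
  rw [hKeq]
  have hsplit := Finset.card_filter_add_card_filter_not (s := K') (fun k => orderOf k ≠ 3)
  have h2 : (K'.filter (fun k => ¬ orderOf k ≠ 3)).card ≤ 2 := by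
    have : K'.filter (fun k => ¬ orderOf k ≠ 3) = K'.filter (fun k => orderOf k = 3) :=
      Finset.filter_congr (fun k _ => not_not)
    rw [this]
    exact card_filter_orderOf_eq_three_le_two K'
  have hmain := abs_card_lemma6_sub_main_le (p := p) hdvd hodd hβ hβ'
  rw [← hK'] at hmain
  -- the main terms agree: `p (1 − 3^{−2β})/2^{2α+2} = p · a₁`, `a₁ = (1 − 9^{−β})/(4·4^α)`
  have ha1 : (p : ℝ) * (1 - 1 / 3 ^ (2 * β)) / 2 ^ (2 * α + 2) = (p : ℝ) * (1 - (1 / 9) ^ β) / (4 * 4 ^ α) := by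
    rw [pow_mul, pow_add, pow_mul, one_div_pow]
    norm_num
    ring
  rw [ha1]
  have hcast : ((K'.filter (fun k => orderOf k ≠ 3)).card : ℝ) + ((K'.filter (fun k => ¬ orderOf k ≠ 3)).card : ℝ)
      = (K'.card : ℝ) := by exact_mod_cast hsplit
  have h2' : ((K'.filter (fun k => ¬ orderOf k ≠ 3)).card : ℝ) ≤ 2 := by exact_mod_cast h2
  have h0' : (0 : ℝ) ≤ ((K'.filter (fun k => ¬ orderOf k ≠ 3)).card : ℝ) := Nat.cast_nonneg _
  rcases Nat.eq_zero_or_pos β with hβ0 | hβpos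
  · -- `β = 0`: `K* = ∅` and the main term vanishes
    subst hβ0
    have hK0 : K' = ∅ := by
      rw [hK', Finset.filter_eq_empty_iff]
      intro k hk h
      simp only [mem_filter, mem_univ, true_and] at hk
      have h1 : 1 ≤ padicValNat 3 (orderOf k) := by omega
      apply hβ'
      rw [zero_add, pow_one]
      exact dvd_trans (dvd_trans (dvd_pow_self 3 (by omega)) (pow_dvd_pow 3 h1))
        (dvd_trans pow_padicValNat_dvd (ZMod.orderOf_dvd_card_sub_one hk.1))
    rw [hK0]
    norm_num
  · -- `β ≥ 1`: `p ≥ 7`, `√p ≥ 2`, `a₁ ≤ 1/4`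
    have h3 : 3 ∣ p - 1 := dvd_trans (dvd_pow_self 3 (by omega)) hβ
    have hp7 : (7 : ℝ) ≤ p := by
      have h6 : 6 ∣ p - 1 := by
        have hp2 : p ≠ 2 := by rintro rfl; norm_num at h3
        obtain ⟨r, hr⟩ := hp.out.odd_of_ne_two hp2
        omega
      have : 7 ≤ p := by
        have := hp.out.two_le
        omega
      exact_mod_cast this
    have hs2 : (2 : ℝ) ≤ Real.sqrt p := by
      rw [show (2 : ℝ) = Real.sqrt 4 by rw [show (4:ℝ) = 2 ^ 2 by norm_num, Real.sqrt_sq (by norm_num)]]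
      exact Real.sqrt_le_sqrt (by linarith)
    have ha_nonneg : (0 : ℝ) ≤ (1 - (1 / 9) ^ β) / (4 * 4 ^ α) := by
      apply div_nonneg _ (by positivity)
      have : ((1 : ℝ) / 9) ^ β ≤ 1 := pow_le_one₀ (by norm_num) (by norm_num)
      linarith
    have ha_le : (1 - (1 / 9 : ℝ) ^ β) / (4 * 4 ^ α) ≤ 1 / 4 := by
      rw [div_le_div_iff₀ (by positivity) (by norm_num)]
      have h1 : (0 : ℝ) ≤ (1 / 9) ^ β := by positivity
      have h4 : (1 : ℝ) ≤ 4 ^ α := one_le_pow₀ (by norm_num)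
      nlinarith
    have hβ1 : (1 : ℝ) ≤ β := by exact_mod_cast hβpos
    have hb : (2 : ℝ) ≤ 4 * (β : ℝ) ^ 2 - 2 * β := by nlinarith
    have hprod : (2 : ℝ) * 2 ≤ (4 * (β : ℝ) ^ 2 - 2 * β) * Real.sqrt p :=
      mul_le_mul hb hs2 (by norm_num) (by linarith)
    -- triangle inequality
    have e1 : |((K'.filter (fun k => orderOf k ≠ 3)).card : ℝ) - (K'.card : ℝ)| ≤ 2 := by
      rw [abs_le]; constructor <;> linarith
    have e3 : |((p : ℝ) - 2) * (1 - (1 / 9) ^ β) / (4 * 4 ^ α) - (p : ℝ) * (1 - (1 / 9) ^ β) / (4 * 4 ^ α)| ≤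
        1 / 2 := by
      rw [show ((p : ℝ) - 2) * (1 - (1 / 9) ^ β) / (4 * 4 ^ α) - (p : ℝ) * (1 - (1 / 9) ^ β) / (4 * 4 ^ α)
        = -(2 * ((1 - (1 / 9) ^ β) / (4 * 4 ^ α))) by ring, abs_neg, abs_of_nonneg (by positivity)]
      linarith
    have t1 := abs_sub_le (((K'.filter (fun k => orderOf k ≠ 3)).card : ℝ)) (K'.card : ℝ)
      ((p : ℝ) * (1 - (1 / 9) ^ β) / (4 * 4 ^ α))
    have t2 := abs_sub_le (K'.card : ℝ) (((p : ℝ) - 2) * (1 - (1 / 9) ^ β) / (4 * 4 ^ α))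
      ((p : ℝ) * (1 - (1 / 9) ^ β) / (4 * 4 ^ α))
    linarith [t1, t2, e1, hmain, e3, hprod]

end ExactCount

end CyclotomicFermatCMType

end Literature.AlgebraicGeometry.ComplexMultiplication
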